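import Literature.MathematicalPhysics.QuantumManyBody.PeriodicBoseGasUpperBound
import Mathlib.MeasureTheory.Constructions.HaarToSphere
import Mathlib.MeasureTheory.Measure.Lebesgue.VolumeOfBalls
import Mathlib.MeasureTheory.Integral.MeanInequalities
import HarnessLib

/-!
# LSSY Theorem 2.2, step 1: the two-body profile (proofs of `LSSY2005_zeroScatteringLength` and `LSSY2005_dysonProfile`)

Topic `Literature/MathematicalPhysics/QuantumManyBody`, sibling of `PeriodicBoseGasUpperBound.lean`
(provefact `Literature.MathematicalPhysics.QuantumManyBody.BoseGas.LSSY2005_upperBound_periodic`). This file *proves* the two named facts of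
`PeriodicBoseGasUpperBound.lean` about the scattering length `a` of `PeriodicBoseGas.lean`
(the variational definition `4πa = inf 𝓔[φ]` over `C¹` functions `φ → 1`,
[LSSY2005, App. C, Thm. C.1]):

* `LSSY2005_zeroScatteringLength_holds`: for measurable `v ≥ 0` of finite range, `a = 0` forces
  `v(|x|) = 0` for a.e. `x`;
* `LSSY2005_dysonProfile_holds`: for `0 < a < ∞` there is `b₀(v)` such that for `b ≥ b₀` and
  `ε > 0` some pair profile with cut-off `b` has `E₁ ≤ 8πa/(1 - a/b) + ε`, `I ≤ 16πab²`,
  `K ≤ 16πab` [(C.8) and (2.27)–(2.32)].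

**Relation to `LSSY2005_scatteringSolution` / `IsScatteringSolution`
(`PeriodicBoseGasLocalization.lean`).** That named fact vendors Thm. C.1 in the interface of the
lower bound: the distributional scattering solution `ω` with `ω = a/|x|` beyond the range and
`∫ v(1 - ω) = 8πa`, meaningful for *integrable* `v`. The upper bound needs something else: an
explicit `C¹` pair profile with values in `[0, 1]`, cut off at a prescribed radius `b`, with
quantitative bounds on `E₁, I, K`, for every measurable `v ≥ 0` of finite range including hard cores
(where no such `ω` exists). Neither statement formally implies the other; the two facts of this
file are therefore proved from the variational definition of `a` directly.

The printed proofs use the minimiser `φ₀ = f₀(|x|)/f₀(b)` of `E_b` (Thm. C.1) and its explicit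
form `1 - a/|x|` beyond the range of `v` ((C.7)–(C.8)), together with `f₀ ≥ [1 - a/r]₊`
(Lemma C.2). With the variational (infimum) definition of `a` and `C¹` trial functions we do not
construct the minimiser; instead the two ingredients it provides are obtained directly:

1. **Polar coordinates and rays.** `∫ F = ∫_{S²} ∫_0^∞ F(rω) r² dr dσ` (`lintegral_eq_lintegral_sphereMeasure`,
   from Mathlib's `measurePreserving_homeomorphUnitSphereProd`, `σ(S²) = 4π`) and
   `(∂ᵣφ)² ≤ |∇φ|²` give `∫_{S²} e[φ(·ω)] dσ ≤ 𝓔[φ]` for the one-dimensional energy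
   `e[g] = ∫ r²(g'² + ½vg²)` (`lintegral_rayEnergy_le`); hence a near-minimiser has a ray of
   small one-dimensional energy (`exists_ray_lt`).
2. **Capacity of the annulus.** For a `C¹` function on a ray, `(g(R) - g(r))² ≤
   (∫_r^R s² g'²)(1/r - 1/R)` (`sq_sub_le_lintegral_mul`, Cauchy–Schwarz) — the elementary content
   of (C.8): the energy beyond radius `R₁` of a function reaching `1` is at least `(1 - g(R₁))² R₁`
   (`ray_capacity`), and small energy forces `g ≈ 1` away from the origin (`setLIntegral_potential_le_of_ray`,
   which proves `LSSY2005_zeroScatteringLength`).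

The profile of `LSSY2005_dysonProfile` is then built in one dimension and radialised
(`radialFun`, `profileEnergy_radialFun` etc.): the inner part on `[0, R₁]` (`R₁ = R₀⁺ + 1`, beyond
the range) is the ray `h` of a near-minimiser, cut off at the origin (`originCut`: the origin has
zero capacity for the weight `r²`), scaled by the optimal factor `λ = cκ/(k + c²κ)` of the series
combination of the inner energy `k` and the annulus capacity `κ = (R₁⁻¹ - b⁻¹)⁻¹`
(`harmonic_comparison`: `λ²k + (1 - λc)²κ ≤ eb/(b - e)` whenever `k + (1-c)²R₁ ≤ e < b`; with
`e < a + ρ` from the ray this is `≤ a_b = a/(1 - a/b)` up to `ρ`), and clamped into `[0, 1]` by a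
`C¹` clamp `s_τ` with `|s_τ'| ≤ 1 + 2τ`, `s_τ(y)² ≤ (1+2τ)²y²`, `s_τ(0) = 0` (so hard cores and
non-integrable `v` are respected; `clamp`, built from `Real.smoothTransition`); then it is glued in
`C¹` fashion (`glue`, across layers of width `θ` where `v = 0`, at energy cost `O(θ)`,
`exists_deriv_glue_bound`) to the harmonic tail `T = 1 - (1-c'')κ(r⁻¹ - b⁻¹)` (`tailFun`,
energy `(1-c'')²κ` exactly) and to `1` at `b` (`dysonG`). The three integrals are then bounded
region by region (`dysonG_energy_le`, `dysonG_defect_le`, `dysonG_K_le`) and the error budget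
`ρ` is chosen by continuity (`exists_rho`); `b₀ = 20a + 4R₁ + 4 + (R₁+1)³/(3a)`.

## References

* [LSSY2005] E. H. Lieb, R. Seiringer, J. P. Solovej, J. Yngvason, *The Mathematics of the Bose
  Gas and its Condensation*, Oberwolfach Seminars 34, Birkhäuser 2005, arXiv:cond-mat/0610117:
  App. C, Thm. C.1 (C.4)–(C.8), Lemma C.2; Thm. 2.2, proof, (2.17)–(2.18), (2.27)–(2.32).
* [LiebYngvason2001] E. H. Lieb, J. Yngvason, *The ground state energy of a dilute
  two-dimensional Bose gas*, J. Stat. Phys. 103 (2001) 509 (the appendix reproduced as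
  [LSSY2005, App. C]).
-/

noncomputable section

open MeasureTheory Measure Metric Set Filter Topology WithLp
open scoped ENNReal NNReal

namespace Literature.MathematicalPhysics.QuantumManyBody.BoseGas

/-! ### Polar coordinates on `ℝ³` -/

section Polar

/-- The surface measure `σ` on the unit sphere `S² ⊂ ℝ³` induced by Lebesgue measure
(`σ(A) = 3 |{tx : x ∈ A, 0 < t < 1}|`), of total mass `4π`. [folklore] -/
abbrev sphereMeasure : Measure (sphere (0 : Space) 1) := (volume : Measure Space).toSphere

/-- `σ(S²) = 4π`. [folklore] -/
theorem sphereMeasure_univ : sphereMeasure univ = ENNReal.ofReal (4 * Real.pi) := by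
  rw [sphereMeasure, toSphere_apply_univ, finrank_euclideanSpace_fin,
    EuclideanSpace.volume_ball_fin_three, ENNReal.ofReal_one, one_pow, one_mul,
    ← ENNReal.ofReal_natCast, ← ENNReal.ofReal_mul (Nat.cast_nonneg _)]
  congr 1
  push_cast
  ring

/-- The sphere has positive surface measure. [folklore] -/
theorem sphereMeasure_ne_zero : sphereMeasure univ ≠ 0 := by
  rw [sphereMeasure_univ, ENNReal.ofReal_ne_zero_iff]; positivity

/-- **Polar coordinates** for the lower Lebesgue integral on `ℝ³`:
`∫ F(x) dx = ∫_{S²} ∫_0^∞ F(rω) r² dr dσ(ω)` (the same identity, with the factors in the other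
order, is `lintegral_eq_lintegral_sphere` of `LiebYngvasonDyson.lean`, developed independently
for the lower bound). [folklore] -/
theorem lintegral_eq_lintegral_sphereMeasure {F : Space → ℝ≥0∞} (hF : Measurable F) :
    ∫⁻ x, F x = ∫⁻ ω, (∫⁻ r in Ioi (0 : ℝ), ENNReal.ofReal (r ^ 2) * F (r • (ω : Space)))
      ∂sphereMeasure := by
  have hmp := (volume : Measure Space).measurePreserving_homeomorphUnitSphereProd
  rw [finrank_euclideanSpace_fin, show (3 : ℕ) - 1 = 2 from rfl] at hmp
  set e := homeomorphUnitSphereProd Space with he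
  have hG : Measurable fun p : sphere (0 : Space) 1 × Ioi (0 : ℝ) => F ((e.symm p : _) : Space) :=
    hF.comp (measurable_subtype_coe.comp e.symm.measurable)
  calc ∫⁻ x, F x = ∫⁻ x in ({0}ᶜ : Set Space), F x := by rw [restrict_compl_singleton]
    _ = ∫⁻ x : ({0}ᶜ : Set Space), F x ∂(volume.comap Subtype.val) :=
        (lintegral_subtype_comap (measurableSet_singleton (0 : Space)).compl F).symm
    _ = ∫⁻ x : ({0}ᶜ : Set Space), F ((e.symm (e x) : _) : Space) ∂(volume.comap Subtype.val) := by
        simp only [Homeomorph.symm_apply_apply]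
    _ = ∫⁻ p, F ((e.symm p : _) : Space) ∂(sphereMeasure.prod (volumeIoiPow 2)) :=
        hmp.lintegral_comp_emb e.measurableEmbedding (fun p => F ((e.symm p : _) : Space))
    _ = ∫⁻ ω, ∫⁻ r, F ((e.symm (ω, r) : _) : Space) ∂(volumeIoiPow 2) ∂sphereMeasure :=
        lintegral_prod _ hG.aemeasurable
    _ = _ := by
        refine lintegral_congr fun ω => ?_
        simp only [he, homeomorphUnitSphereProd_symm_apply_coe]
        have hm1 : Measurable fun r : Ioi (0 : ℝ) => ENNReal.ofReal ((r : ℝ) ^ 2) :=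
          (measurable_subtype_coe.pow_const 2).ennreal_ofReal
        have hm2 : Measurable fun r : Ioi (0 : ℝ) => F ((r : ℝ) • (ω : Space)) :=
          hF.comp (measurable_subtype_coe.smul_const _)
        rw [volumeIoiPow, lintegral_withDensity_eq_lintegral_mul _ hm1 hm2,
          ← lintegral_subtype_comap measurableSet_Ioi
            (fun r : ℝ => ENNReal.ofReal (r ^ 2) * F (r • (ω : Space)))]
        rfl

/-- Polar coordinates for a radial function: `∫ F(|x|) dx = 4π ∫_0^∞ F(r) r² dr`
(cf. `lintegral_radial` of `LiebYngvasonDyson.lean`). [folklore] -/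
theorem lintegral_comp_norm_eq_sphere {F : ℝ → ℝ≥0∞} (hF : Measurable F) :
    ∫⁻ x : Space, F ‖x‖ = ENNReal.ofReal (4 * Real.pi) * ∫⁻ r in Ioi (0 : ℝ), ENNReal.ofReal (r ^ 2) * F r := by
  rw [lintegral_eq_lintegral_sphereMeasure (F := fun x => F ‖x‖) (hF.comp measurable_norm)]
  have h : ∀ ω : sphere (0 : Space) 1, (∫⁻ r in Ioi (0 : ℝ), ENNReal.ofReal (r ^ 2) * F ‖r • (ω : Space)‖) =
      ∫⁻ r in Ioi (0 : ℝ), ENNReal.ofReal (r ^ 2) * F r := by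
    intro ω
    refine setLIntegral_congr_fun measurableSet_Ioi fun r hr => ?_
    rw [norm_smul, norm_eq_of_mem_sphere ω, mul_one, Real.norm_of_nonneg (le_of_lt hr)]
  simp_rw [h]
  rw [lintegral_const, sphereMeasure_univ, mul_comm]

end Polar

/-! ### Rays: directional derivatives and the radial part of the energy -/

section Rays

/-- `(‖t‖₊)² = t²` in `ℝ≥0∞` for real `t`. [folklore] -/
theorem ennnorm_sq_eq_ofReal_sq (t : ℝ) : ((‖t‖₊ : ℝ≥0∞)) ^ 2 = ENNReal.ofReal (t ^ 2) := by
  rw [← enorm_eq_nnnorm, Real.enorm_eq_ofReal_abs, ← ENNReal.ofReal_pow (abs_nonneg _), sq_abs]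

/-- `|∇φ(x)|² = ∑ₖ (∂ₖφ(x))²` as `ofReal` of a real sum. [folklore] -/
theorem gradSq_eq_ofReal_sum (φ : Space → ℝ) (x : Space) :
    gradSq φ x = ENNReal.ofReal (∑ k : Fin 3, (fderiv ℝ φ x (EuclideanSpace.single k (1 : ℝ))) ^ 2) := by
  rw [gradSq, ENNReal.ofReal_sum_of_nonneg fun k _ => sq_nonneg _]
  exact Finset.sum_congr rfl fun k _ => ennnorm_sq_eq_ofReal_sq _

/-- **Directional derivatives are bounded by the gradient**: `(Dφ(x)ω)² ≤ |∇φ(x)|²` for `|ω| ≤ 1`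
(expand `ω` in the standard basis and use Cauchy–Schwarz). [folklore] -/
theorem sq_fderiv_apply_le_sum (φ : Space → ℝ) (x ω : Space) (hω : ‖ω‖ ≤ 1) :
    (fderiv ℝ φ x ω) ^ 2 ≤ ∑ k : Fin 3, (fderiv ℝ φ x (EuclideanSpace.single k (1 : ℝ))) ^ 2 := by
  have hω' : ω = ∑ k : Fin 3, ω k • EuclideanSpace.single k (1 : ℝ) := by
    conv_lhs => rw [← (EuclideanSpace.basisFun (Fin 3) ℝ).sum_repr ω]
    simp
  have h1 : fderiv ℝ φ x ω = ∑ k : Fin 3, ω k * fderiv ℝ φ x (EuclideanSpace.single k (1 : ℝ)) := by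
    conv_lhs => rw [hω']
    rw [_root_.map_sum]
    simp only [map_smul, smul_eq_mul]
  have h2 : ∑ k : Fin 3, ω k ^ 2 ≤ 1 := by
    rw [← EuclideanSpace.real_norm_sq_eq]
    nlinarith [norm_nonneg ω]
  rw [h1]
  calc (∑ k, ω k * fderiv ℝ φ x (EuclideanSpace.single k 1)) ^ 2
      ≤ (∑ k, ω k ^ 2) * ∑ k, (fderiv ℝ φ x (EuclideanSpace.single k 1)) ^ 2 :=
        Finset.sum_mul_sq_le_sq_mul_sq _ _ _
    _ ≤ 1 * ∑ k, (fderiv ℝ φ x (EuclideanSpace.single k 1)) ^ 2 :=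
        mul_le_mul_of_nonneg_right h2 (Finset.sum_nonneg fun k _ => sq_nonneg _)
    _ = _ := one_mul _

/-- `(Dφ(x)ω)² ≤ |∇φ(x)|²` in `ℝ≥0∞`, for `|ω| ≤ 1`. [folklore] -/
theorem ofReal_sq_fderiv_apply_le_gradSq (φ : Space → ℝ) (x ω : Space) (hω : ‖ω‖ ≤ 1) :
    ENNReal.ofReal ((fderiv ℝ φ x ω) ^ 2) ≤ gradSq φ x := by
  rw [gradSq_eq_ofReal_sum]
  exact ENNReal.ofReal_le_ofReal (sq_fderiv_apply_le_sum φ x ω hω)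

variable {φ : Space → ℝ}

/-- The restriction `r ↦ φ(rω)` of `φ` to the line through `ω`. [cite: LSSY2005, App. C, proof of Thm. C.1] -/
def rayFun (φ : Space → ℝ) (ω : Space) (r : ℝ) : ℝ := φ (r • ω)

/-- Rays of `C¹` functions are `C¹`. [folklore] -/
theorem contDiff_rayFun (hφ : ContDiff ℝ 1 φ) (ω : Space) : ContDiff ℝ 1 (rayFun φ ω) :=
  hφ.comp (contDiff_id.smul contDiff_const)

/-- The derivative along the ray: `(φ(·ω))'(r) = Dφ(rω)ω`. [folklore] -/
theorem hasDerivAt_rayFun (hφ : Differentiable ℝ φ) (ω : Space) (r : ℝ) :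
    HasDerivAt (rayFun φ ω) (fderiv ℝ φ (r • ω) ω) r := by
  have h := (hφ (r • ω)).hasFDerivAt.comp_hasDerivAt r ((hasDerivAt_id r).smul_const ω)
  rw [one_smul] at h
  exact h

/-- `(φ(·ω))'(r) = Dφ(rω)ω`. [folklore] -/
theorem deriv_rayFun (hφ : Differentiable ℝ φ) (ω : Space) (r : ℝ) :
    deriv (rayFun φ ω) r = fderiv ℝ φ (r • ω) ω :=
  (hasDerivAt_rayFun hφ ω r).deriv

/-- The one-dimensional energy density of a function `g` on a ray: `r² (g'(r)² + ½ v(r) g(r)²)`.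
[cite: LSSY2005, App. C (C.4) in polar coordinates] -/
def rayDensity (v : ℝ → ℝ≥0∞) (g : ℝ → ℝ) (r : ℝ) : ℝ≥0∞ :=
  ENNReal.ofReal (r ^ 2) * (ENNReal.ofReal (deriv g r ^ 2) + 2⁻¹ * v r * ENNReal.ofReal (g r ^ 2))

/-- The energy of `φ` along the ray through `ω`: `∫_0^∞ r² ((∂ᵣφ)² + ½ v φ²)(rω) dr`.
[cite: LSSY2005, App. C (C.4) in polar coordinates] -/
def rayEnergy (v : ℝ → ℝ≥0∞) (φ : Space → ℝ) (ω : Space) : ℝ≥0∞ :=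
  ∫⁻ r in Ioi (0 : ℝ), rayDensity v (rayFun φ ω) r

/-- The ray density is measurable. [folklore] -/
theorem measurable_rayDensity {v : ℝ → ℝ≥0∞} (hv : Measurable v) {g : ℝ → ℝ} (hg : Continuous g) :
    Measurable (rayDensity v g) := by
  unfold rayDensity
  refine (measurable_id.pow_const 2).ennreal_ofReal.mul
    (((measurable_deriv g).pow_const 2).ennreal_ofReal.add ?_)
  exact (measurable_const.mul hv).mul (hg.measurable.pow_const 2).ennreal_ofReal

/-- On the ray, the 1D density is bounded by the 3D integrand:
`r²((∂ᵣφ)² + ½vφ²)(rω) ≤ r²(|∇φ|² + ½vφ²)(rω)` for `ω ∈ S²`, `r > 0`. [cite: LSSY2005, App. C, proof of Thm. C.1] -/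
theorem rayDensity_le (hφ : Differentiable ℝ φ) (v : ℝ → ℝ≥0∞) (ω : sphere (0 : Space) 1)
    {r : ℝ} (hr : 0 < r) :
    rayDensity v (rayFun φ ω) r ≤ ENNReal.ofReal (r ^ 2) *
      (gradSq φ (r • (ω : Space)) + 2⁻¹ * v ‖r • (ω : Space)‖ *
        ((‖φ (r • (ω : Space))‖₊ : ℝ≥0∞)) ^ 2) := by
  unfold rayDensity
  refine mul_le_mul' le_rfl (add_le_add ?_ (le_of_eq ?_))
  · rw [deriv_rayFun hφ]
    exact ofReal_sq_fderiv_apply_le_gradSq φ _ _ (norm_eq_of_mem_sphere ω).le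
  · rw [norm_smul, norm_eq_of_mem_sphere ω, mul_one, Real.norm_of_nonneg hr.le,
      ennnorm_sq_eq_ofReal_sq]
    rfl

/-- **The energy dominates the integral of the ray energies**: `∫_{S²} e[φ(·ω)] dσ(ω) ≤ 𝓔[φ]`.
[cite: LSSY2005, App. C, proof of Thm. C.1] -/
theorem lintegral_rayEnergy_le (hφ : ContDiff ℝ 1 φ) {v : ℝ → ℝ≥0∞} (hv : Measurable v) :
    ∫⁻ ω, rayEnergy v φ ω ∂sphereMeasure ≤ scatteringFunctional v φ := by
  have hm1 : Measurable (gradSq φ) := by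
    rw [show gradSq φ = fun x => ENNReal.ofReal (∑ k : Fin 3,
      (fderiv ℝ φ x (EuclideanSpace.single k (1 : ℝ))) ^ 2) from funext (gradSq_eq_ofReal_sum φ)]
    refine Measurable.ennreal_ofReal (Finset.measurable_sum _ fun k _ => ?_)
    exact (measurable_fderiv_apply_const ℝ φ _).pow_const 2
  have hm2 : Measurable fun x : Space => 2⁻¹ * v ‖x‖ * ((‖φ x‖₊ : ℝ≥0∞)) ^ 2 :=
    (measurable_const.mul (hv.comp measurable_norm)).mul
      (hφ.continuous.measurable.nnnorm.coe_nnreal_ennreal.pow_const 2)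
  have hm : Measurable fun x : Space => gradSq φ x + 2⁻¹ * v ‖x‖ * ((‖φ x‖₊ : ℝ≥0∞)) ^ 2 :=
    hm1.add hm2
  rw [scatteringFunctional, lintegral_eq_lintegral_sphereMeasure hm]
  refine lintegral_mono fun ω => ?_
  exact setLIntegral_mono' measurableSet_Ioi fun r hr =>
    rayDensity_le (hφ.differentiable one_ne_zero) v ω hr

end Rays

/-! ### The one-dimensional Cauchy–Schwarz bound -/

section OneDim

/-- `∫_r^R s⁻² ds = 1/r - 1/R` for `0 < r ≤ R`. [folklore] -/
theorem integral_inv_sq {r R : ℝ} (hr : 0 < r) (hrR : r ≤ R) :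
    ∫ s in r..R, (s ^ 2)⁻¹ = 1 / r - 1 / R := by
  have h : ∀ s ∈ uIcc r R, HasDerivAt (fun s : ℝ => -s⁻¹) ((s ^ 2)⁻¹) s := by
    intro s hs
    rw [uIcc_of_le hrR] at hs
    have hs0 : s ≠ 0 := (hr.trans_le hs.1).ne'
    have h1 := (hasDerivAt_inv hs0).neg
    rw [neg_neg] at h1
    exact h1
  rw [intervalIntegral.integral_eq_sub_of_hasDerivAt h]
  · simp only [one_div]; ring
  · refine ContinuousOn.intervalIntegrable ?_
    rw [uIcc_of_le hrR]
    exact continuousOn_of_forall_continuousAt fun s hs =>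
      ((continuous_pow 2).continuousAt).inv₀ (pow_ne_zero 2 (hr.trans_le hs.1).ne')

/-- `∫_{(r,R]} s⁻² ds = 1/r - 1/R` as a lower integral. [folklore] -/
theorem lintegral_inv_sq {r R : ℝ} (hr : 0 < r) (hrR : r ≤ R) :
    ∫⁻ s in Ioc r R, ENNReal.ofReal ((s ^ 2)⁻¹) = ENNReal.ofReal (1 / r - 1 / R) := by
  have hcont : ContinuousOn (fun s : ℝ => (s ^ 2)⁻¹) (Icc r R) :=
    continuousOn_of_forall_continuousAt fun s hs =>
      ((continuous_pow 2).continuousAt).inv₀ (pow_ne_zero 2 (hr.trans_le hs.1).ne')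
  have hint : IntegrableOn (fun s : ℝ => (s ^ 2)⁻¹) (Ioc r R) :=
    (hcont.integrableOn_Icc).mono_set Ioc_subset_Icc_self
  rw [← integral_inv_sq hr hrR, intervalIntegral.integral_of_le hrR,
    ofReal_integral_eq_lintegral_ofReal hint]
  exact Eventually.of_forall fun s => by positivity

/-- **Weighted Cauchy–Schwarz on a ray.** For a `C¹` function `g` and `0 < r ≤ R`:
`(g(R) - g(r))² ≤ (∫_r^R s² g'(s)² ds) · (1/r - 1/R)`, since `g(R) - g(r) = ∫ (s g')(s⁻¹)`.
This is the elementary capacity estimate behind `f₀(r) ≥ 1 - a/r` and the positivity of the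
scattering length. [cite: LSSY2005, App. C, Lemma C.2 and (C.8)] -/
theorem sq_sub_le_lintegral_mul {g : ℝ → ℝ} (hg : ContDiff ℝ 1 g) {r R : ℝ} (hr : 0 < r)
    (hrR : r ≤ R) :
    ENNReal.ofReal ((g R - g r) ^ 2) ≤
      (∫⁻ s in Ioc r R, ENNReal.ofReal (s ^ 2 * deriv g s ^ 2)) * ENNReal.ofReal (1 / r - 1 / R) := by
  set μ : Measure ℝ := volume.restrict (Ioc r R) with hμ
  have hderiv : ∀ s ∈ uIcc r R, HasDerivAt g (deriv g s) s := fun s _ =>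
    ((hg.differentiable one_ne_zero) s).hasDerivAt
  have hcd : Continuous (deriv g) := hg.continuous_deriv le_rfl
  -- Step 1: `|g R - g r| ≤ ∫ |g'|`
  have h1 : |g R - g r| ≤ ∫ s in Ioc r R, |deriv g s| := by
    rw [← intervalIntegral.integral_eq_sub_of_hasDerivAt hderiv (hcd.intervalIntegrable _ _),
      ← intervalIntegral.integral_of_le hrR]
    exact intervalIntegral.abs_integral_le_integral_abs hrR
  -- Step 2: as a lower integral of a product
  have h2 : ENNReal.ofReal |g R - g r| ≤
      ∫⁻ s, ENNReal.ofReal (s * |deriv g s|) * ENNReal.ofReal (s⁻¹) ∂μ := by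
    refine (ENNReal.ofReal_le_ofReal h1).trans ?_
    rw [ofReal_integral_eq_lintegral_ofReal (hcd.abs.integrableOn_Ioc)
      (Eventually.of_forall fun s => abs_nonneg _)]
    refine (setLIntegral_congr_fun measurableSet_Ioc fun s hs => ?_).le
    have hs0 : 0 < s := hr.trans hs.1
    rw [← ENNReal.ofReal_mul (by positivity)]
    congr 1
    field_simp
  -- Step 3: Hölder with exponents `2, 2`
  have hmeas1 : AEMeasurable (fun s : ℝ => ENNReal.ofReal (s * |deriv g s|)) μ :=
    (measurable_id.mul hcd.abs.measurable).ennreal_ofReal.aemeasurable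
  have hmeas2 : AEMeasurable (fun s : ℝ => ENNReal.ofReal (s⁻¹)) μ :=
    measurable_inv.ennreal_ofReal.aemeasurable
  have h3 := ENNReal.lintegral_mul_le_Lp_mul_Lq μ Real.HolderConjugate.two_two hmeas1 hmeas2
  simp only [Pi.mul_apply] at h3
  -- Step 4: square
  have h4 : ENNReal.ofReal ((g R - g r) ^ 2) = (ENNReal.ofReal |g R - g r|) ^ 2 := by
    rw [← ENNReal.ofReal_pow (abs_nonneg _), sq_abs]
  have hA : ∫⁻ s, ENNReal.ofReal (s * |deriv g s|) ^ (2 : ℝ) ∂μ =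
      ∫⁻ s in Ioc r R, ENNReal.ofReal (s ^ 2 * deriv g s ^ 2) := by
    rw [hμ]
    refine setLIntegral_congr_fun measurableSet_Ioc fun s hs => ?_
    have hs0 : 0 ≤ s := (hr.trans hs.1).le
    rw [ENNReal.rpow_two, ← ENNReal.ofReal_pow (mul_nonneg hs0 (abs_nonneg _))]
    congr 1
    rw [mul_pow, sq_abs]
  have hB : ∫⁻ s, ENNReal.ofReal (s⁻¹) ^ (2 : ℝ) ∂μ = ENNReal.ofReal (1 / r - 1 / R) := by
    rw [hμ, ← lintegral_inv_sq hr hrR]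
    refine setLIntegral_congr_fun measurableSet_Ioc fun s hs => ?_
    rw [ENNReal.rpow_two, ← ENNReal.ofReal_pow (inv_nonneg.mpr (hr.trans hs.1).le), inv_pow]
  rw [h4]
  calc (ENNReal.ofReal |g R - g r|) ^ 2
      ≤ (∫⁻ s, ENNReal.ofReal (s * |deriv g s|) * ENNReal.ofReal (s⁻¹) ∂μ) ^ 2 := by
        gcongr
    _ ≤ ((∫⁻ s, ENNReal.ofReal (s * |deriv g s|) ^ (2 : ℝ) ∂μ) ^ (1 / 2 : ℝ) *
          (∫⁻ s, ENNReal.ofReal (s⁻¹) ^ (2 : ℝ) ∂μ) ^ (1 / 2 : ℝ)) ^ 2 := by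
        gcongr
    _ = (∫⁻ s, ENNReal.ofReal (s * |deriv g s|) ^ (2 : ℝ) ∂μ) *
          ∫⁻ s, ENNReal.ofReal (s⁻¹) ^ (2 : ℝ) ∂μ := by
        rw [← ENNReal.mul_rpow_of_nonneg _ _ (by norm_num : (0 : ℝ) ≤ 1 / 2), ← ENNReal.rpow_two,
          ← ENNReal.rpow_mul]
        norm_num
    _ = _ := by rw [hA, hB]

end OneDim

/-! ### Zero scattering length forces `v = 0` a.e. -/

section ZeroScattering

/-- An admissible scattering trial function is `1` outside some ball. [folklore] -/
theorem IsScatteringTrial.exists_eq_one {φ : Space → ℝ} (hφ : IsScatteringTrial φ) :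
    ∃ R : ℝ, ∀ x : Space, R < ‖x‖ → φ x = 1 := by
  obtain ⟨R, hR⟩ := hφ.2.isCompact.isBounded.subset_closedBall 0
  refine ⟨R, fun x hx => ?_⟩
  have hx' : x ∉ tsupport fun x => 1 - φ x := fun h => by
    have := hR h
    rw [mem_closedBall, dist_zero_right] at this
    linarith
  have := image_eq_zero_of_notMem_tsupport hx'
  linarith

/-- If the scattering length vanishes, there are admissible functions with a ray of arbitrarily
small one-dimensional energy. [cite: LSSY2005, App. C, Thm. C.1] -/
theorem exists_ray_lt_of_scatteringLength_eq_zero {v : ℝ → ℝ≥0∞} (hv : Measurable v)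
    (h0 : scatteringLength v = 0) {η : ℝ≥0∞} (hη : 0 < η) :
    ∃ φ : Space → ℝ, IsScatteringTrial φ ∧ ∃ ω : sphere (0 : Space) 1, rayEnergy v φ ω < η := by
  have h4 : ENNReal.ofReal (4 * Real.pi) ≠ 0 := by
    rw [ENNReal.ofReal_ne_zero_iff]; positivity
  have hinf : (⨅ (φ : Space → ℝ) (_ : IsScatteringTrial φ), scatteringFunctional v φ) = 0 := by
    rw [scatteringLength, mul_eq_zero] at h0
    exact h0.resolve_left (ENNReal.inv_ne_zero.mpr ENNReal.ofReal_ne_top)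
  have hpos : 0 < η * ENNReal.ofReal (4 * Real.pi) := ENNReal.mul_pos hη.ne' h4
  rw [← hinf] at hpos
  obtain ⟨φ, hφ⟩ := iInf_lt_iff.mp hpos
  obtain ⟨hφt, hφE⟩ := iInf_lt_iff.mp hφ
  refine ⟨φ, hφt, ?_⟩
  by_contra hall
  push Not at hall
  have h1 : ∫⁻ _ω, η ∂sphereMeasure ≤ ∫⁻ ω, rayEnergy v φ ω ∂sphereMeasure :=
    lintegral_mono fun ω => hall ω
  rw [lintegral_const, sphereMeasure_univ] at h1
  exact (lt_irrefl _) ((h1.trans (lintegral_rayEnergy_le hφt.1 hv)).trans_lt hφE)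

/-- **The ray argument.** If a `C¹` function `h` on a ray has `h(R) = 1` and one-dimensional
energy `< η ≤ δ/16` (`0 < δ < R`), then `h² ≥ 1/2` on `(δ, R]` and hence
`∫_{(δ,R]} s² v(s) ds ≤ 4η`. [cite: LSSY2005, App. C, Lemma C.2] -/
theorem setLIntegral_potential_le_of_ray {v : ℝ → ℝ≥0∞} (hv : Measurable v) {h : ℝ → ℝ}
    (hh : ContDiff ℝ 1 h) {δ R : ℝ} (hδ : 0 < δ) (hδR : δ < R) (hR : h R = 1) {η : ℝ≥0∞}
    (hηδ : η ≤ ENNReal.ofReal (δ / 16)) (hE : ∫⁻ s in Ioi (0 : ℝ), rayDensity v h s < η) :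
    ∫⁻ s in Ioc δ R, ENNReal.ofReal (s ^ 2) * v s ≤ 4 * η := by
  have hηtop : η ≠ ⊤ := ne_top_of_le_ne_top ENNReal.ofReal_ne_top hηδ
  have hR0 : 0 < R := hδ.trans hδR
  set F : ℝ → ℝ≥0∞ := fun s => ENNReal.ofReal (s ^ 2) * v s with hF
  have hFm : Measurable F := ((measurable_id.pow_const 2).ennreal_ofReal).mul hv
  -- kinetic part on `(t, R]` is `< η`
  have hkin : ∀ t, 0 < t → (∫⁻ s in Ioc t R, ENNReal.ofReal (s ^ 2 * deriv h s ^ 2)) ≤ η := by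
    intro t ht
    refine le_trans ?_ hE.le
    calc ∫⁻ s in Ioc t R, ENNReal.ofReal (s ^ 2 * deriv h s ^ 2)
        ≤ ∫⁻ s in Ioc t R, rayDensity v h s := by
          refine lintegral_mono fun s => ?_
          rw [rayDensity, ENNReal.ofReal_mul (sq_nonneg _)]
          exact mul_le_mul' le_rfl le_self_add
      _ ≤ ∫⁻ s in Ioi (0 : ℝ), rayDensity v h s :=
          lintegral_mono_set fun s hs => ht.trans hs.1
  -- hence `h ≥ 3/4` on `(δ, R]`
  have hval : ∀ t ∈ Ioc δ R, 1 / 2 ≤ h t ^ 2 := by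
    intro t ht
    have ht0 : 0 < t := hδ.trans ht.1
    have h1 := sq_sub_le_lintegral_mul hh ht0 ht.2
    rw [hR] at h1
    have h2 : ENNReal.ofReal ((1 - h t) ^ 2) ≤ η * ENNReal.ofReal (1 / t - 1 / R) :=
      h1.trans (mul_le_mul' (hkin t ht0) le_rfl)
    have h3 : ENNReal.ofReal ((1 - h t) ^ 2) ≤ ENNReal.ofReal (δ / 16) * ENNReal.ofReal (1 / δ) := by
      refine h2.trans (mul_le_mul' hηδ (ENNReal.ofReal_le_ofReal ?_))
      have : 1 / t ≤ 1 / δ := one_div_le_one_div_of_le hδ ht.1.le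
      have : 0 ≤ 1 / R := one_div_nonneg.mpr hR0.le
      linarith
    rw [← ENNReal.ofReal_mul (by positivity), ENNReal.ofReal_le_ofReal_iff (by positivity)] at h3
    have h4 : (1 - h t) ^ 2 ≤ 1 / 16 := by
      have : δ / 16 * (1 / δ) = 1 / 16 := by field_simp
      linarith
    nlinarith [sq_nonneg (1 - h t - 1 / 4), sq_nonneg (h t - 3 / 4), sq_abs (1 - h t), abs_nonneg (1 - h t)]
  -- the potential part
  have hpot : (∫⁻ s in Ioc δ R, F s) * (2⁻¹ * 2⁻¹) ≤ η := by
    rw [← lintegral_mul_const _ hFm]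
    refine le_trans ?_ hE.le
    calc ∫⁻ s in Ioc δ R, F s * (2⁻¹ * 2⁻¹)
        ≤ ∫⁻ s in Ioc δ R, rayDensity v h s := by
          refine setLIntegral_mono' measurableSet_Ioc fun s hs => ?_
          rw [rayDensity, hF]
          have h12 : (2⁻¹ : ℝ≥0∞) ≤ ENNReal.ofReal (h s ^ 2) := by
            rw [← ENNReal.ofReal_ofNat, ← ENNReal.ofReal_inv_of_pos two_pos, ← one_div]
            exact ENNReal.ofReal_le_ofReal (hval s hs)
          calc ENNReal.ofReal (s ^ 2) * v s * (2⁻¹ * 2⁻¹)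
              = ENNReal.ofReal (s ^ 2) * (2⁻¹ * v s * 2⁻¹) := by ring
            _ ≤ ENNReal.ofReal (s ^ 2) * (2⁻¹ * v s * ENNReal.ofReal (h s ^ 2)) :=
                mul_le_mul' le_rfl (mul_le_mul' le_rfl h12)
            _ ≤ _ := mul_le_mul' le_rfl le_add_self
      _ ≤ ∫⁻ s in Ioi (0 : ℝ), rayDensity v h s := lintegral_mono_set fun s hs => hδ.trans hs.1
  have h22 : (2⁻¹ * 2⁻¹ * 4 : ℝ≥0∞) = 1 := by
    rw [show (4 : ℝ≥0∞) = 2 * 2 by norm_num, ← mul_assoc, mul_assoc 2⁻¹ 2⁻¹ 2,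
      ENNReal.inv_mul_cancel two_ne_zero ENNReal.ofNat_ne_top, mul_one,
      ENNReal.inv_mul_cancel two_ne_zero ENNReal.ofNat_ne_top]
  calc ∫⁻ s in Ioc δ R, F s
      = (∫⁻ s in Ioc δ R, F s) * (2⁻¹ * 2⁻¹) * 4 := by
        rw [mul_assoc, h22, mul_one]
    _ ≤ η * 4 := mul_le_mul' hpot le_rfl
    _ = 4 * η := mul_comm _ _

/-- **LSSY 2005, App. C: zero scattering length means no interaction, proved.**
[cite: LSSY2005, App. C, Thm. C.1 (C.8) and Lemma C.2] -/
theorem LSSY2005_zeroScatteringLength_holds : LSSY2005_zeroScatteringLength := by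
  intro v R₀ hv hR₀ h0
  -- Step 1: `∫_{(δ,∞)} s² v(s) ds = 0` for every `δ > 0`
  have hIoi : ∀ δ : ℝ, 0 < δ → ∫⁻ s in Ioi δ, ENNReal.ofReal (s ^ 2) * v s = 0 := by
    intro δ hδ
    refine le_antisymm (ENNReal.le_of_forall_pos_le_add fun ε hε _ => ?_) bot_le
    rw [zero_add]
    -- an admissible function with a good ray
    have hη : (0 : ℝ≥0∞) < min ((ε : ℝ≥0∞) / 4) (ENNReal.ofReal (δ / 16)) := by
      refine lt_min ?_ ?_
      · exact ENNReal.div_pos (by exact_mod_cast hε.ne') (by norm_num)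
      · rw [ENNReal.ofReal_pos]; positivity
    obtain ⟨φ, hφ, ω, hω⟩ := exists_ray_lt_of_scatteringLength_eq_zero hv h0 hη
    obtain ⟨Rφ, hRφ⟩ := hφ.exists_eq_one
    set R : ℝ := max (max Rφ R₀) δ + 1 with hR_def
    have hδR : δ < R := by
      have := le_max_right (max Rφ R₀) δ; linarith
    have hR₀R : R₀ < R := by
      have := (le_max_right Rφ R₀).trans (le_max_left (max Rφ R₀) δ); linarith
    have hRφR : Rφ < R := by
      have := (le_max_left Rφ R₀).trans (le_max_left (max Rφ R₀) δ); linarith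
    have hR1 : rayFun φ ω R = 1 := by
      refine hRφ _ ?_
      rw [norm_smul, norm_eq_of_mem_sphere ω, mul_one, Real.norm_of_nonneg (hδ.trans hδR).le]
      exact hRφR
    have hray := setLIntegral_potential_le_of_ray hv (contDiff_rayFun hφ.1 ω) hδ hδR hR1
      (min_le_right _ _) hω
    -- beyond `R` the potential vanishes
    have hsplit : ∫⁻ s in Ioi δ, ENNReal.ofReal (s ^ 2) * v s =
        ∫⁻ s in Ioc δ R, ENNReal.ofReal (s ^ 2) * v s := by
      have h1 : ∫⁻ s in Ioi δ, ENNReal.ofReal (s ^ 2) * v s =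
          ∫⁻ s in Ioi δ, (Ioc δ R).indicator (fun s => ENNReal.ofReal (s ^ 2) * v s) s := by
        refine setLIntegral_congr_fun measurableSet_Ioi fun s hs => ?_
        by_cases hsR : s ≤ R
        · rw [indicator_of_mem (show s ∈ Ioc δ R from ⟨hs, hsR⟩)]
        · rw [indicator_of_notMem (fun h => hsR h.2), hR₀ s (hR₀R.trans (not_le.mp hsR)),
            mul_zero]
      rw [h1, lintegral_indicator measurableSet_Ioc, Measure.restrict_restrict measurableSet_Ioc,
        inter_eq_left.mpr Ioc_subset_Ioi_self]
    rw [hsplit]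
    calc ∫⁻ s in Ioc δ R, ENNReal.ofReal (s ^ 2) * v s
        ≤ 4 * min ((ε : ℝ≥0∞) / 4) (ENNReal.ofReal (δ / 16)) := hray
      _ ≤ 4 * ((ε : ℝ≥0∞) / 4) := mul_le_mul' le_rfl (min_le_left _ _)
      _ = ε := ENNReal.mul_div_cancel (by norm_num) (by norm_num)
  -- Step 2: `∫_{(0,∞)} s² v = 0`
  have hIoi0 : ∫⁻ s in Ioi (0 : ℝ), ENNReal.ofReal (s ^ 2) * v s = 0 := by
    have hU : Ioi (0 : ℝ) = ⋃ n : ℕ, Ioi (1 / ((n : ℝ) + 1)) := by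
      ext s
      simp only [mem_Ioi, mem_iUnion]
      constructor
      · intro hs
        obtain ⟨n, hn⟩ := exists_nat_one_div_lt hs
        exact ⟨n, hn⟩
      · rintro ⟨n, hn⟩
        exact lt_trans (by positivity) hn
    rw [hU]
    refine le_antisymm ((lintegral_iUnion_le _ _).trans (le_of_eq ?_)) bot_le
    exact ENNReal.tsum_eq_zero.mpr fun n => hIoi _ (by positivity)
  -- Step 3: back to `ℝ³`
  have hm : Measurable fun x : Space => v ‖x‖ := hv.comp measurable_norm
  have h3 : ∫⁻ x : Space, v ‖x‖ = 0 := by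
    rw [lintegral_comp_norm_eq_sphere hv, hIoi0, mul_zero]
  exact (lintegral_eq_zero_iff hm).mp h3

end ZeroScattering

/-! ### Smooth steps -/

section Step

open Real

/-- The smooth step `χ(r) = ST((r - r₀)/θ)`: `0` for `r ≤ r₀`, `1` for `r ≥ r₀ + θ`, values in
`[0, 1]` (`ST` = `Real.smoothTransition`). [folklore] -/
def smoothStep (r₀ θ r : ℝ) : ℝ := smoothTransition ((r - r₀) / θ)

variable {r₀ θ : ℝ}

/-- The smooth step is smooth. [folklore] -/
theorem smoothStep_contDiff (r₀ θ : ℝ) {n : ℕ∞} : ContDiff ℝ n (smoothStep r₀ θ) :=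
  smoothTransition.contDiff.comp ((contDiff_id.sub contDiff_const).div_const θ)

/-- The smooth step vanishes to the left of the layer. [folklore] -/
theorem smoothStep_of_le (hθ : 0 < θ) {r : ℝ} (hr : r ≤ r₀) : smoothStep r₀ θ r = 0 :=
  smoothTransition.zero_of_nonpos (div_nonpos_of_nonpos_of_nonneg (by linarith) hθ.le)

/-- The smooth step is `1` to the right of the layer. [folklore] -/
theorem smoothStep_of_ge (hθ : 0 < θ) {r : ℝ} (hr : r₀ + θ ≤ r) : smoothStep r₀ θ r = 1 :=
  smoothTransition.one_of_one_le ((one_le_div hθ).mpr (by linarith))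

/-- `0 ≤ χ`. [folklore] -/
theorem smoothStep_nonneg (r : ℝ) : 0 ≤ smoothStep r₀ θ r := smoothTransition.nonneg _

/-- `χ ≤ 1`. [folklore] -/
theorem smoothStep_le_one (r : ℝ) : smoothStep r₀ θ r ≤ 1 := smoothTransition.le_one _

/-- A bound for the derivative of `Real.smoothTransition` on `[0, 1]`. [folklore] -/
theorem exists_bound_deriv_smoothTransition :
    ∃ M : ℝ, 0 ≤ M ∧ ∀ y ∈ Icc (0 : ℝ) 1, |deriv smoothTransition y| ≤ M := by
  obtain ⟨M, hM⟩ := isCompact_Icc.exists_bound_of_continuousOn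
    ((smoothTransition.contDiff (n := 1)).continuous_deriv le_rfl).continuousOn
  exact ⟨max M 0, le_max_right _ _, fun y hy => (hM y hy).trans (le_max_left _ _)⟩

/-- The derivative of `ST` vanishes outside `(0, 1)`. [folklore] -/
theorem deriv_smoothTransition_of_one_le {y : ℝ} (hy : 1 ≤ y) : deriv smoothTransition y = 0 := by
  refine IsLocalMax.deriv_eq_zero ?_
  filter_upwards with z
  rw [smoothTransition.one_of_one_le hy]
  exact smoothTransition.le_one z

/-- The derivative of `ST` vanishes on `(-∞, 0]`. [folklore] -/
theorem deriv_smoothTransition_of_nonpos {y : ℝ} (hy : y ≤ 0) : deriv smoothTransition y = 0 := by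
  refine IsLocalMin.deriv_eq_zero ?_
  filter_upwards with z
  rw [smoothTransition.zero_of_nonpos hy]
  exact smoothTransition.nonneg z

/-- Chain rule for the smooth step: `χ'(r) = ST'((r - r₀)/θ)/θ`. [folklore] -/
theorem hasDerivAt_smoothStep (r : ℝ) :
    HasDerivAt (smoothStep r₀ θ) (deriv smoothTransition ((r - r₀) / θ) / θ) r := by
  have h1 : HasDerivAt (fun r : ℝ => (r - r₀) / θ) (1 / θ) r := by
    simpa using ((hasDerivAt_id r).sub_const r₀).div_const θ
  have h2 := (smoothTransition.contDiff (n := 1)).differentiable (by norm_num) ((r - r₀) / θ)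
  have h := h2.hasDerivAt.comp r h1
  rw [mul_one_div] at h
  exact h

/-- `χ'(r) = ST'((r - r₀)/θ)/θ`. [folklore] -/
theorem deriv_smoothStep (r : ℝ) :
    deriv (smoothStep r₀ θ) r = deriv smoothTransition ((r - r₀) / θ) / θ :=
  (hasDerivAt_smoothStep r).deriv

/-- The derivative of the step vanishes off the layer `(r₀, r₀ + θ)`. [folklore] -/
theorem deriv_smoothStep_of_ge (hθ : 0 < θ) {r : ℝ} (hr : r₀ + θ ≤ r) : deriv (smoothStep r₀ θ) r = 0 := by
  rw [deriv_smoothStep, deriv_smoothTransition_of_one_le ((one_le_div hθ).mpr (by linarith)),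
    zero_div]

/-- `χ' = 0` to the left of the layer. [folklore] -/
theorem deriv_smoothStep_of_le (hθ : 0 < θ) {r : ℝ} (hr : r ≤ r₀) : deriv (smoothStep r₀ θ) r = 0 := by
  rw [deriv_smoothStep,
    deriv_smoothTransition_of_nonpos (div_nonpos_of_nonpos_of_nonneg (by linarith) hθ.le), zero_div]

/-- On the layer, `|χ'| ≤ M/θ`. [folklore] -/
theorem abs_deriv_smoothStep_le (hθ : 0 < θ) {M : ℝ}
    (hM : ∀ y ∈ Icc (0 : ℝ) 1, |deriv smoothTransition y| ≤ M) {r : ℝ} (hr : r ∈ Icc r₀ (r₀ + θ)) :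
    |deriv (smoothStep r₀ θ) r| ≤ M / θ := by
  rw [deriv_smoothStep, abs_div, abs_of_pos hθ]
  refine div_le_div_of_nonneg_right (hM _ ⟨div_nonneg (by linarith [hr.1]) hθ.le, ?_⟩) hθ.le
  rw [div_le_one hθ]; linarith [hr.2]

end Step

/-! ### A `C¹` clamp onto `[0, 1]` -/

section Clamp

open Real intervalIntegral

variable {τ : ℝ}

/-- The plateau function `σ_τ(w) = ST(w/τ) ST((1 + 2τ - w)/τ) ∈ [0,1]`: vanishes off
`(0, 1 + 2τ)` and equals `1` on `[τ, 1 + τ]`. [folklore] -/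
def plateau (τ w : ℝ) : ℝ := smoothTransition (w / τ) * smoothTransition ((1 + 2 * τ - w) / τ)

/-- The plateau function is continuous. [folklore] -/
theorem plateau_continuous (τ : ℝ) : Continuous (plateau τ) := by
  unfold plateau
  exact (smoothTransition.continuous.comp (continuous_id.div_const τ)).mul
    (smoothTransition.continuous.comp ((continuous_const.sub continuous_id).div_const τ))

/-- `0 ≤ σ_τ`. [folklore] -/
theorem plateau_nonneg (w : ℝ) : 0 ≤ plateau τ w :=
  mul_nonneg (smoothTransition.nonneg _) (smoothTransition.nonneg _)

/-- `σ_τ ≤ 1`. [folklore] -/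
theorem plateau_le_one (w : ℝ) : plateau τ w ≤ 1 :=
  mul_le_one₀ (smoothTransition.le_one _) (smoothTransition.nonneg _) (smoothTransition.le_one _)

/-- `σ_τ = 0` on `(-∞, 0]`. [folklore] -/
theorem plateau_of_nonpos (hτ : 0 < τ) {w : ℝ} (hw : w ≤ 0) : plateau τ w = 0 := by
  rw [plateau, smoothTransition.zero_of_nonpos (div_nonpos_of_nonpos_of_nonneg hw hτ.le), zero_mul]

/-- `σ_τ = 0` on `[1 + 2τ, ∞)`. [folklore] -/
theorem plateau_of_ge (hτ : 0 < τ) {w : ℝ} (hw : 1 + 2 * τ ≤ w) : plateau τ w = 0 := by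
  rw [plateau, smoothTransition.zero_of_nonpos (x := (1 + 2 * τ - w) / τ)
    (div_nonpos_of_nonpos_of_nonneg (by linarith) hτ.le), mul_zero]

/-- `σ_τ = 1` on the plateau `[τ, 1 + τ]`. [folklore] -/
theorem plateau_of_mem (hτ : 0 < τ) {w : ℝ} (hw : w ∈ Icc τ (1 + τ)) : plateau τ w = 1 := by
  rw [plateau, smoothTransition.one_of_one_le ((one_le_div hτ).mpr hw.1),
    smoothTransition.one_of_one_le ((one_le_div hτ).mpr (by linarith [hw.2])), mul_one]

/-- The plateau function is integrable on intervals. [folklore] -/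
theorem plateau_intervalIntegrable (τ a b : ℝ) : IntervalIntegrable (plateau τ) volume a b :=
  (plateau_continuous τ).intervalIntegrable a b

/-- The normalisation `Z_τ = ∫_0^{1+2τ} σ_τ ∈ [1, 1 + 2τ]`. [folklore] -/
def plateauMass (τ : ℝ) : ℝ := ∫ w in (0 : ℝ)..(1 + 2 * τ), plateau τ w

/-- `Z_τ ≥ 1` (the plateau has length `1`). [folklore] -/
theorem one_le_plateauMass (hτ : 0 < τ) : 1 ≤ plateauMass τ := by
  have h1 : ∫ w in τ..(1 + τ), plateau τ w = 1 := by
    rw [integral_congr (g := fun _ => (1 : ℝ)) (fun w hw => ?_), intervalIntegral.integral_const,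
      smul_eq_mul, mul_one]
    · ring
    · rw [uIcc_of_le (by linarith)] at hw
      exact plateau_of_mem hτ hw
  rw [← h1, plateauMass]
  exact integral_mono_interval (by linarith) (by linarith) (by linarith)
    (Eventually.of_forall fun w => plateau_nonneg w) (plateau_intervalIntegrable τ _ _)

/-- `Z_τ ≤ 1 + 2τ`. [folklore] -/
theorem plateauMass_le (hτ : 0 < τ) : plateauMass τ ≤ 1 + 2 * τ := by
  have h := integral_mono_on (μ := volume) (a := 0) (b := 1 + 2 * τ) (by linarith)
    (plateau_intervalIntegrable τ _ _) (intervalIntegrable_const (c := (1 : ℝ)))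
    (fun w _ => plateau_le_one w)
  rw [intervalIntegral.integral_const, smul_eq_mul, mul_one, sub_zero] at h
  exact h

/-- `Z_τ > 0`. [folklore] -/
theorem plateauMass_pos (hτ : 0 < τ) : 0 < plateauMass τ := one_pos.trans_le (one_le_plateauMass hτ)

/-- The primitive clamp `S_τ(u) = Z_τ⁻¹ ∫_0^u σ_τ`: `C¹`, non-decreasing with slope `≤ 1`, `0` on
`(-∞, 0]`, `1` on `[1 + 2τ, ∞)`. [folklore] -/
def clampPrim (τ u : ℝ) : ℝ := (∫ w in (0 : ℝ)..u, plateau τ w) / plateauMass τ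

/-- `S_τ' = σ_τ/Z_τ` (fundamental theorem of calculus). [folklore] -/
theorem hasDerivAt_clampPrim (u : ℝ) :
    HasDerivAt (clampPrim τ) (plateau τ u / plateauMass τ) u := by
  unfold clampPrim
  exact ((plateau_continuous τ).integral_hasStrictDerivAt 0 u).hasDerivAt.div_const _

/-- `S_τ' = σ_τ/Z_τ`. [folklore] -/
theorem deriv_clampPrim (u : ℝ) : deriv (clampPrim τ) u = plateau τ u / plateauMass τ :=
  (hasDerivAt_clampPrim u).deriv

/-- `S_τ` is `C¹`. [folklore] -/
theorem clampPrim_contDiff (τ : ℝ) : ContDiff ℝ 1 (clampPrim τ) := by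
  rw [contDiff_one_iff_deriv]
  refine ⟨fun u => (hasDerivAt_clampPrim u).differentiableAt, ?_⟩
  rw [show deriv (clampPrim τ) = fun u => plateau τ u / plateauMass τ from
    funext (deriv_clampPrim)]
  exact (plateau_continuous τ).div_const _

/-- `S_τ' ≥ 0`. [folklore] -/
theorem deriv_clampPrim_nonneg (hτ : 0 < τ) (u : ℝ) : 0 ≤ deriv (clampPrim τ) u := by
  rw [deriv_clampPrim]; exact div_nonneg (plateau_nonneg u) (plateauMass_pos hτ).le

/-- `S_τ' ≤ 1`. [folklore] -/
theorem deriv_clampPrim_le_one (hτ : 0 < τ) (u : ℝ) : deriv (clampPrim τ) u ≤ 1 := by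
  rw [deriv_clampPrim, div_le_one (plateauMass_pos hτ)]
  exact (plateau_le_one u).trans (one_le_plateauMass hτ)

/-- `S_τ(0) = 0`. [folklore] -/
theorem clampPrim_zero (τ : ℝ) : clampPrim τ 0 = 0 := by simp [clampPrim]

/-- `S_τ` is non-decreasing. [folklore] -/
theorem clampPrim_monotone (hτ : 0 < τ) : Monotone (clampPrim τ) :=
  monotone_of_deriv_nonneg ((clampPrim_contDiff τ).differentiable (by norm_num))
    (deriv_clampPrim_nonneg hτ)

/-- `S_τ = 0` on `(-∞, 0]`. [folklore] -/
theorem clampPrim_of_nonpos (hτ : 0 < τ) {u : ℝ} (hu : u ≤ 0) : clampPrim τ u = 0 := by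
  unfold clampPrim
  rw [integral_congr (g := fun _ => (0 : ℝ)) (fun w hw => ?_), intervalIntegral.integral_zero,
    zero_div]
  rw [uIcc_of_ge hu] at hw
  exact plateau_of_nonpos hτ hw.2

/-- `S_τ = 1` on `[1 + 2τ, ∞)`. [folklore] -/
theorem clampPrim_of_ge (hτ : 0 < τ) {u : ℝ} (hu : 1 + 2 * τ ≤ u) : clampPrim τ u = 1 := by
  unfold clampPrim
  rw [← integral_add_adjacent_intervals (plateau_intervalIntegrable τ 0 (1 + 2 * τ))
    (plateau_intervalIntegrable τ (1 + 2 * τ) u),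
    integral_congr (g := fun _ => (0 : ℝ)) (a := 1 + 2 * τ) (fun w hw => ?_),
    intervalIntegral.integral_zero, add_zero, ← plateauMass, div_self (plateauMass_pos hτ).ne']
  rw [uIcc_of_le hu] at hw
  exact plateau_of_ge hτ hw.1

/-- `0 ≤ S_τ`. [folklore] -/
theorem clampPrim_nonneg (hτ : 0 < τ) (u : ℝ) : 0 ≤ clampPrim τ u := by
  rcases le_or_gt u 0 with hu | hu
  · rw [clampPrim_of_nonpos hτ hu]
  · simpa [clampPrim_zero] using clampPrim_monotone hτ hu.le

/-- `S_τ ≤ 1`. [folklore] -/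
theorem clampPrim_le_one' (hτ : 0 < τ) (u : ℝ) : clampPrim τ u ≤ 1 := by
  rcases le_or_gt u (1 + 2 * τ) with hu | hu
  · simpa [clampPrim_of_ge hτ le_rfl] using clampPrim_monotone hτ hu
  · rw [clampPrim_of_ge hτ hu.le]

/-- `S_τ(u) ≤ u` for `u ≥ 0` (slope at most `1`, `S_τ(0) = 0`). [folklore] -/
theorem clampPrim_le_self (hτ : 0 < τ) {u : ℝ} (hu : 0 ≤ u) : clampPrim τ u ≤ u := by
  have h := (convex_Icc 0 u).image_sub_le_mul_sub_of_deriv_le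
    (clampPrim_contDiff τ).continuous.continuousOn
    (((clampPrim_contDiff τ).differentiable (by norm_num)).differentiableOn.mono interior_subset)
    (fun x _ => deriv_clampPrim_le_one hτ x) 0 (left_mem_Icc.mpr hu) u (right_mem_Icc.mpr hu) hu
  simpa [clampPrim_zero] using h

/-- `S_τ(u) ≥ (u - τ)/Z_τ ≥ (u - τ)/(1 + 2τ)` for `u ∈ [τ, 1 + τ]`. [folklore] -/
theorem clampPrim_ge (hτ : 0 < τ) {u : ℝ} (hu : u ∈ Icc τ (1 + τ)) : (u - τ) / (1 + 2 * τ) ≤ clampPrim τ u := by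
  have h1 : ∫ w in τ..u, plateau τ w = u - τ := by
    rw [integral_congr (g := fun _ => (1 : ℝ)) (fun w hw => ?_), intervalIntegral.integral_const,
      smul_eq_mul, mul_one]
    rw [uIcc_of_le hu.1] at hw
    exact plateau_of_mem hτ ⟨hw.1, hw.2.trans hu.2⟩
  have h2 : u - τ ≤ ∫ w in (0 : ℝ)..u, plateau τ w := by
    rw [← h1]
    exact integral_mono_interval (by linarith [hu.1]) hu.1 le_rfl
      (Eventually.of_forall fun w => plateau_nonneg w) (plateau_intervalIntegrable τ _ _)
  rw [clampPrim]
  calc (u - τ) / (1 + 2 * τ) ≤ (u - τ) / plateauMass τ :=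
        div_le_div_of_nonneg_left (by linarith [hu.1]) (plateauMass_pos hτ) (plateauMass_le hτ)
    _ ≤ _ := div_le_div_of_nonneg_right h2 (plateauMass_pos hτ).le

/-- **The clamp** `s_τ(y) = S_τ((1 + 2τ) y)`: a `C¹` map `ℝ → [0, 1]` with `s_τ = 0` on `(-∞, 0]`,
`s_τ = 1` on `[1, ∞)`, `|s_τ'| ≤ 1 + 2τ`, `s_τ(y)² ≤ (1 + 2τ)² y²` and `|s_τ(y) - y| ≤ 2τ` on
`[0, 1]` — a `C¹` substitute for `y ↦ min(max(y, 0), 1)`. [folklore] -/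
def clamp (τ y : ℝ) : ℝ := clampPrim τ ((1 + 2 * τ) * y)

/-- The clamp is `C¹`. [folklore] -/
theorem clamp_contDiff (τ : ℝ) : ContDiff ℝ 1 (clamp τ) :=
  (clampPrim_contDiff τ).comp (contDiff_const.mul contDiff_id)

/-- `s_τ'(y) = (1 + 2τ) σ_τ((1+2τ)y)/Z_τ`. [folklore] -/
theorem hasDerivAt_clamp (y : ℝ) :
    HasDerivAt (clamp τ) (plateau τ ((1 + 2 * τ) * y) / plateauMass τ * (1 + 2 * τ)) y := by
  have h1 : HasDerivAt (fun y : ℝ => (1 + 2 * τ) * y) (1 + 2 * τ) y := by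
    simpa using (hasDerivAt_id y).const_mul (1 + 2 * τ)
  exact (hasDerivAt_clampPrim _).comp y h1

/-- `|s_τ'| ≤ 1 + 2τ`. [folklore] -/
theorem abs_deriv_clamp_le (hτ : 0 < τ) (y : ℝ) : |deriv (clamp τ) y| ≤ 1 + 2 * τ := by
  rw [(hasDerivAt_clamp y).deriv, abs_mul, abs_of_pos (by linarith : (0 : ℝ) < 1 + 2 * τ)]
  refine mul_le_of_le_one_left (by linarith) ?_
  rw [abs_of_nonneg (div_nonneg (plateau_nonneg _) (plateauMass_pos hτ).le),
    div_le_one (plateauMass_pos hτ)]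
  exact (plateau_le_one _).trans (one_le_plateauMass hτ)

/-- `0 ≤ s_τ`. [folklore] -/
theorem clamp_nonneg (hτ : 0 < τ) (y : ℝ) : 0 ≤ clamp τ y := clampPrim_nonneg hτ _

/-- `s_τ ≤ 1`. [folklore] -/
theorem clamp_le_one (hτ : 0 < τ) (y : ℝ) : clamp τ y ≤ 1 := clampPrim_le_one' hτ _

/-- `s_τ = 0` on `(-∞, 0]` (in particular `s_τ(0) = 0`: hard cores are respected). [folklore] -/
theorem clamp_of_nonpos (hτ : 0 < τ) {y : ℝ} (hy : y ≤ 0) : clamp τ y = 0 :=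
  clampPrim_of_nonpos hτ (mul_nonpos_of_nonneg_of_nonpos (by linarith) hy)

/-- `s_τ = 1` on `[1, ∞)`. [folklore] -/
theorem clamp_of_one_le (hτ : 0 < τ) {y : ℝ} (hy : 1 ≤ y) : clamp τ y = 1 :=
  clampPrim_of_ge hτ (by nlinarith)

/-- `s_τ(y) ≤ (1 + 2τ) y` for `y ≥ 0`. [folklore] -/
theorem clamp_le_mul (hτ : 0 < τ) {y : ℝ} (hy : 0 ≤ y) : clamp τ y ≤ (1 + 2 * τ) * y :=
  clampPrim_le_self hτ (by positivity)

/-- `s_τ(y)² ≤ (1 + 2τ)² y²` for all `y`. [folklore] -/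
theorem clamp_sq_le (hτ : 0 < τ) (y : ℝ) : clamp τ y ^ 2 ≤ (1 + 2 * τ) ^ 2 * y ^ 2 := by
  rcases le_or_gt y 0 with hy | hy
  · rw [clamp_of_nonpos hτ hy]; simp only [ne_eq, OfNat.ofNat_ne_zero, not_false_eq_true, zero_pow]
    positivity
  · rw [← mul_pow]
    exact pow_le_pow_left₀ (clamp_nonneg hτ y) (clamp_le_mul hτ hy.le) 2

/-- `|s_τ(y) - y| ≤ 2τ` on `[0, 1]` (for `τ ≤ 1/2`). [folklore] -/
theorem abs_clamp_sub_le (hτ : 0 < τ) (hτ1 : τ ≤ 1 / 2) {y : ℝ} (hy : y ∈ Icc (0 : ℝ) 1) :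
    |clamp τ y - y| ≤ 2 * τ := by
  rw [abs_le]
  constructor
  · -- lower bound
    have h12 : 0 < 1 + 2 * τ := by linarith
    rcases le_or_gt ((1 + 2 * τ) * y) τ with h | h
    · have : y ≤ τ := by nlinarith [hy.1]
      linarith [clamp_nonneg hτ y]
    · rcases le_or_gt ((1 + 2 * τ) * y) (1 + τ) with h' | h'
      · have h2 : (1 + 2 * τ) * y ∈ Icc τ (1 + τ) := ⟨h.le, h'⟩
        have h3 := clampPrim_ge hτ h2
        rw [clamp]
        have h4 : ((1 + 2 * τ) * y - τ) / (1 + 2 * τ) = y - τ / (1 + 2 * τ) := by field_simp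
        have h5 : τ / (1 + 2 * τ) ≤ τ := div_le_self hτ.le (by linarith)
        linarith
      · have h2 : (1 + τ : ℝ) ∈ Icc τ (1 + τ) := ⟨by linarith, le_rfl⟩
        have h3 := clampPrim_ge hτ h2
        have h4 : clampPrim τ (1 + τ) ≤ clamp τ y := clampPrim_monotone hτ h'.le
        have h5 : (1 + τ - τ) / (1 + 2 * τ) = 1 / (1 + 2 * τ) := by ring
        have h6 : 1 - 2 * τ ≤ 1 / (1 + 2 * τ) := by
          rw [le_div_iff₀ h12]; nlinarith
        linarith [hy.2]
  · have := clamp_le_mul hτ hy.1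
    nlinarith [hy.2]

end Clamp

/-! ### `C¹` gluing across a thin layer -/

section Glue

variable {u w : ℝ → ℝ} {r₀ θ : ℝ}

/-- The glued function `(1 - χ) u + χ w` with `χ` the smooth step on `[r₀, r₀ + θ]`: equals `u` to
the left of the layer and `w` to the right of it. [folklore] -/
def glue (r₀ θ : ℝ) (u w : ℝ → ℝ) (r : ℝ) : ℝ :=
  (1 - smoothStep r₀ θ r) * u r + smoothStep r₀ θ r * w r

/-- Gluing `C¹` functions gives a `C¹` function. [folklore] -/
theorem glue_contDiff (hu : ContDiff ℝ 1 u) (hw : ContDiff ℝ 1 w) (r₀ θ : ℝ) :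
    ContDiff ℝ 1 (glue r₀ θ u w) :=
  ((contDiff_const.sub (smoothStep_contDiff r₀ θ)).mul hu).add ((smoothStep_contDiff r₀ θ).mul hw)

/-- To the left of the layer the glued function is `u`. [folklore] -/
theorem glue_of_le (hθ : 0 < θ) {r : ℝ} (hr : r ≤ r₀) : glue r₀ θ u w r = u r := by
  simp [glue, smoothStep_of_le hθ hr]

/-- To the right of the layer the glued function is `w`. [folklore] -/
theorem glue_of_ge (hθ : 0 < θ) {r : ℝ} (hr : r₀ + θ ≤ r) : glue r₀ θ u w r = w r := by
  simp [glue, smoothStep_of_ge hθ hr]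

/-- The glued value is a convex combination of `u r` and `w r`. [folklore] -/
theorem glue_eq_add (r : ℝ) : glue r₀ θ u w r = u r + smoothStep r₀ θ r * (w r - u r) := by
  rw [glue]; ring

/-- If `u ≤ w` at a point then `u ≤` glue there. [folklore] -/
theorem le_glue {r : ℝ} (h : u r ≤ w r) : u r ≤ glue r₀ θ u w r := by
  rw [glue_eq_add]
  nlinarith [smoothStep_nonneg (r₀ := r₀) (θ := θ) r]

/-- If `u ≤ w` at a point then glue `≤ w` there. [folklore] -/
theorem glue_le {r : ℝ} (h : u r ≤ w r) : glue r₀ θ u w r ≤ w r := by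
  rw [glue_eq_add]
  nlinarith [smoothStep_le_one (r₀ := r₀) (θ := θ) r]

/-- The glue of non-negative values is non-negative. [folklore] -/
theorem glue_nonneg {r : ℝ} (hu : 0 ≤ u r) (hw : 0 ≤ w r) : 0 ≤ glue r₀ θ u w r :=
  add_nonneg (mul_nonneg (sub_nonneg.mpr (smoothStep_le_one r)) hu) (mul_nonneg (smoothStep_nonneg r) hw)

/-- The glue of values `≤ 1` is `≤ 1`. [folklore] -/
theorem glue_le_one {r : ℝ} (hu : u r ≤ 1) (hw : w r ≤ 1) : glue r₀ θ u w r ≤ 1 := by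
  have h0 := smoothStep_nonneg (r₀ := r₀) (θ := θ) r
  have h1 := smoothStep_le_one (r₀ := r₀) (θ := θ) r
  rw [glue]
  nlinarith

/-- Product rule for the glued function: `((1-χ)u + χw)' = χ'(w - u) + (1-χ)u' + χw'`. [folklore] -/
theorem hasDerivAt_glue (hu : ContDiff ℝ 1 u) (hw : ContDiff ℝ 1 w) (r : ℝ) :
    HasDerivAt (glue r₀ θ u w) (deriv (smoothStep r₀ θ) r * (w r - u r) +
      (1 - smoothStep r₀ θ r) * deriv u r + smoothStep r₀ θ r * deriv w r) r := by
  have hχ := hasDerivAt_smoothStep (r₀ := r₀) (θ := θ) r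
  have hu' := ((hu.differentiable (by norm_num)) r).hasDerivAt
  have hw' := ((hw.differentiable (by norm_num)) r).hasDerivAt
  have h := (((hasDerivAt_const r (1 : ℝ)).fun_sub hχ).fun_mul hu').fun_add (hχ.fun_mul hw')
  rw [hχ.deriv]
  exact h.congr_deriv (by ring)

/-- `((1-χ)u + χw)' = χ'(w - u) + (1-χ)u' + χw'`. [folklore] -/
theorem deriv_glue (hu : ContDiff ℝ 1 u) (hw : ContDiff ℝ 1 w) (r : ℝ) :
    deriv (glue r₀ θ u w) r = deriv (smoothStep r₀ θ) r * (w r - u r) +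
      (1 - smoothStep r₀ θ r) * deriv u r + smoothStep r₀ θ r * deriv w r :=
  (hasDerivAt_glue hu hw r).deriv

/-- To the left of the layer the derivative of the glued function is `u'`. [folklore] -/
theorem deriv_glue_of_le (hu : ContDiff ℝ 1 u) (hw : ContDiff ℝ 1 w) (hθ : 0 < θ) {r : ℝ}
    (hr : r ≤ r₀) : deriv (glue r₀ θ u w) r = deriv u r := by
  rw [deriv_glue hu hw, deriv_smoothStep_of_le hθ hr, smoothStep_of_le hθ hr]; ring

/-- To the right of the layer the derivative of the glued function is `w'`. [folklore] -/
theorem deriv_glue_of_ge (hu : ContDiff ℝ 1 u) (hw : ContDiff ℝ 1 w) (hθ : 0 < θ) {r : ℝ}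
    (hr : r₀ + θ ≤ r) : deriv (glue r₀ θ u w) r = deriv w r := by
  rw [deriv_glue hu hw, deriv_smoothStep_of_ge hθ hr, smoothStep_of_ge hθ hr]; ring

/-- **Uniform derivative bound on the gluing layer.** If `u, w` are `C¹` and agree at one end of a
layer `[r₀, r₀ + θ] ⊆ [A, B]` of width `θ ≤ 1`, then `|((1-χ)u + χw)'| ≤ C` on the layer with `C`
depending only on `u, w, A, B` (not on `θ`): `|χ'| ≤ M/θ` is compensated by `|w - u| ≤ D θ`.
[folklore] -/
theorem exists_deriv_glue_bound (hu : ContDiff ℝ 1 u) (hw : ContDiff ℝ 1 w) (A B : ℝ) :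
    ∃ C : ℝ, 0 ≤ C ∧ ∀ r₀ θ : ℝ, 0 < θ → θ ≤ 1 → A ≤ r₀ → r₀ + θ ≤ B →
      (u r₀ = w r₀ ∨ u (r₀ + θ) = w (r₀ + θ)) →
      ∀ r ∈ Icc r₀ (r₀ + θ), |deriv (glue r₀ θ u w) r| ≤ C := by
  obtain ⟨M, hM0, hM⟩ := exists_bound_deriv_smoothTransition
  obtain ⟨D₁, hD₁⟩ := isCompact_Icc.exists_bound_of_continuousOn (s := Icc A B)
    ((hu.continuous_deriv le_rfl).continuousOn)
  obtain ⟨D₂, hD₂⟩ := isCompact_Icc.exists_bound_of_continuousOn (s := Icc A B)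
    ((hw.continuous_deriv le_rfl).continuousOn)
  set D := max D₁ 0 + max D₂ 0 with hD
  have hD0 : 0 ≤ D := add_nonneg (le_max_right _ _) (le_max_right _ _)
  have hu' : ∀ r ∈ Icc A B, |deriv u r| ≤ max D₁ 0 := fun r hr =>
    (Real.norm_eq_abs _ ▸ hD₁ r hr).trans (le_max_left _ _)
  have hw' : ∀ r ∈ Icc A B, |deriv w r| ≤ max D₂ 0 := fun r hr =>
    (Real.norm_eq_abs _ ▸ hD₂ r hr).trans (le_max_left _ _)
  have hud := hu.differentiable (by norm_num)
  have hwd := hw.differentiable (by norm_num)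
  refine ⟨M * D + D, by positivity, ?_⟩
  intro r₀ θ hθ hθ1 hA hB h0 r hr
  have hsub : Icc r₀ (r₀ + θ) ⊆ Icc A B := Icc_subset_Icc hA hB
  -- `|w r - u r| ≤ D θ`
  have hf : ∀ x ∈ Icc r₀ (r₀ + θ), DifferentiableAt ℝ (fun x => w x - u x) x := fun x _ =>
    (hwd x).sub (hud x)
  have hbound : ∀ x ∈ Icc r₀ (r₀ + θ), ‖deriv (fun x => w x - u x) x‖ ≤ D := by
    intro x hx
    rw [deriv_fun_sub (hwd x) (hud x), Real.norm_eq_abs]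
    have h1 := hu' x (hsub hx)
    have h2 := hw' x (hsub hx)
    calc |deriv w x - deriv u x| ≤ |deriv w x| + |deriv u x| := abs_sub _ _
      _ ≤ D := by rw [hD]; linarith
  have hdiff : |w r - u r| ≤ D * θ := by
    rcases h0 with h0 | h0
    · have h := Convex.norm_image_sub_le_of_norm_deriv_le hf hbound (convex_Icc _ _)
        (left_mem_Icc.mpr (by linarith)) hr
      simp only [h0, sub_self, sub_zero, Real.norm_eq_abs] at h
      refine h.trans (mul_le_mul_of_nonneg_left ?_ hD0)
      rw [abs_of_nonneg (by linarith [hr.1])]; linarith [hr.2]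
    · have h := Convex.norm_image_sub_le_of_norm_deriv_le hf hbound (convex_Icc _ _)
        (right_mem_Icc.mpr (by linarith)) hr
      simp only [h0, sub_self, sub_zero, Real.norm_eq_abs] at h
      refine h.trans (mul_le_mul_of_nonneg_left ?_ hD0)
      rw [abs_of_nonpos (by linarith [hr.2])]; linarith [hr.1]
  -- assemble
  rw [deriv_glue hu hw]
  have hχ' := abs_deriv_smoothStep_le (r₀ := r₀) hθ hM hr
  have hχ0 := smoothStep_nonneg (r₀ := r₀) (θ := θ) r
  have hχ1 := smoothStep_le_one (r₀ := r₀) (θ := θ) r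
  have h1 : |deriv (smoothStep r₀ θ) r * (w r - u r)| ≤ M * D := by
    rw [abs_mul]
    calc |deriv (smoothStep r₀ θ) r| * |w r - u r| ≤ M / θ * (D * θ) :=
          mul_le_mul hχ' hdiff (abs_nonneg _) (div_nonneg hM0 hθ.le)
      _ = M * D := by field_simp
  have h2 : |(1 - smoothStep r₀ θ r) * deriv u r| ≤ max D₁ 0 := by
    rw [abs_mul, abs_of_nonneg (by linarith)]
    exact (mul_le_of_le_one_left (abs_nonneg _) (by linarith)).trans (hu' r (hsub hr))
  have h3 : |smoothStep r₀ θ r * deriv w r| ≤ max D₂ 0 := by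
    rw [abs_mul, abs_of_nonneg hχ0]
    exact (mul_le_of_le_one_left (abs_nonneg _) hχ1).trans (hw' r (hsub hr))
  calc |deriv (smoothStep r₀ θ) r * (w r - u r) + (1 - smoothStep r₀ θ r) * deriv u r +
        smoothStep r₀ θ r * deriv w r|
      ≤ |deriv (smoothStep r₀ θ) r * (w r - u r)| + |(1 - smoothStep r₀ θ r) * deriv u r| +
        |smoothStep r₀ θ r * deriv w r| := abs_add_three _ _ _
    _ ≤ M * D + D := by rw [hD]; linarith

/-- **Energy of a thin layer.** A derivative bound `|g'| ≤ C` on `[r₀, r₀ + θ]` (`r₀ ≥ 0`,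
`θ ≤ 1`) gives `∫_{(r₀, r₀+θ]} r² g'(r)² dr ≤ (r₀ + 1)² C² θ`. [folklore] -/
theorem layer_lintegral_le {g : ℝ → ℝ} {r₀ θ C : ℝ} (hr₀ : 0 ≤ r₀) (hθ : 0 < θ) (hθ1 : θ ≤ 1)
    (hC : ∀ r ∈ Icc r₀ (r₀ + θ), |deriv g r| ≤ C) :
    ∫⁻ r in Ioc r₀ (r₀ + θ), ENNReal.ofReal (r ^ 2 * deriv g r ^ 2) ≤
      ENNReal.ofReal ((r₀ + 1) ^ 2 * C ^ 2 * θ) := by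
  have hC0 : 0 ≤ C := (abs_nonneg _).trans (hC r₀ (left_mem_Icc.mpr (by linarith)))
  calc ∫⁻ r in Ioc r₀ (r₀ + θ), ENNReal.ofReal (r ^ 2 * deriv g r ^ 2)
      ≤ ∫⁻ _ in Ioc r₀ (r₀ + θ), ENNReal.ofReal ((r₀ + 1) ^ 2 * C ^ 2) := by
        refine setLIntegral_mono' measurableSet_Ioc fun r hr => ENNReal.ofReal_le_ofReal ?_
        have h1 : r ^ 2 ≤ (r₀ + 1) ^ 2 :=
          pow_le_pow_left₀ (hr₀.trans hr.1.le) (by linarith [hr.2]) 2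
        have h2 : deriv g r ^ 2 ≤ C ^ 2 := by
          have := hC r ⟨hr.1.le, hr.2⟩
          rw [← sq_abs]
          exact pow_le_pow_left₀ (abs_nonneg _) this 2
        exact mul_le_mul h1 h2 (sq_nonneg _) (by positivity)
    _ = ENNReal.ofReal ((r₀ + 1) ^ 2 * C ^ 2 * θ) := by
        rw [setLIntegral_const, Real.volume_Ioc, add_sub_cancel_left,
          ← ENNReal.ofReal_mul (by positivity)]

end Glue

/-! ### Cutting off at the origin -/

section OriginCut

variable {h : ℝ → ℝ} {δ₀ : ℝ}

/-- `χ₀ h` with `χ₀` the smooth step on `[δ₀, 2δ₀]`: vanishes on `(-∞, δ₀]`, equals `h` on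
`[2δ₀, ∞)`. [folklore] -/
def originCut (δ₀ : ℝ) (h : ℝ → ℝ) (r : ℝ) : ℝ := smoothStep δ₀ δ₀ r * h r

/-- The cut-off function is `C¹`. [folklore] -/
theorem originCut_contDiff (hh : ContDiff ℝ 1 h) (δ₀ : ℝ) : ContDiff ℝ 1 (originCut δ₀ h) :=
  (smoothStep_contDiff δ₀ δ₀).mul hh

/-- `χ₀ h = 0` on `(-∞, δ₀]`. [folklore] -/
theorem originCut_of_le (hδ : 0 < δ₀) {r : ℝ} (hr : r ≤ δ₀) : originCut δ₀ h r = 0 := by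
  simp [originCut, smoothStep_of_le hδ hr]

/-- `χ₀ h = h` on `[2δ₀, ∞)`. [folklore] -/
theorem originCut_of_ge (hδ : 0 < δ₀) {r : ℝ} (hr : 2 * δ₀ ≤ r) : originCut δ₀ h r = h r := by
  simp [originCut, smoothStep_of_ge hδ (show δ₀ + δ₀ ≤ r by linarith)]

/-- `(χ₀ h)² ≤ h²` (the cut-off does not increase the potential energy). [folklore] -/
theorem originCut_sq_le (r : ℝ) : originCut δ₀ h r ^ 2 ≤ h r ^ 2 := by
  rw [originCut, mul_pow]
  refine mul_le_of_le_one_left (sq_nonneg _) ?_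
  have h0 := smoothStep_nonneg (r₀ := δ₀) (θ := δ₀) r
  have h1 := smoothStep_le_one (r₀ := δ₀) (θ := δ₀) r
  nlinarith

/-- Product rule for the cut-off function. [folklore] -/
theorem hasDerivAt_originCut (hh : ContDiff ℝ 1 h) (r : ℝ) :
    HasDerivAt (originCut δ₀ h)
      (deriv (smoothStep δ₀ δ₀) r * h r + smoothStep δ₀ δ₀ r * deriv h r) r := by
  have hχ := hasDerivAt_smoothStep (r₀ := δ₀) (θ := δ₀) r
  have h := hχ.mul ((hh.differentiable (by norm_num)) r).hasDerivAt
  rw [hχ.deriv]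
  exact h

/-- `(χ₀ h)' = χ₀' h + χ₀ h'`. [folklore] -/
theorem deriv_originCut (hh : ContDiff ℝ 1 h) (r : ℝ) :
    deriv (originCut δ₀ h) r = deriv (smoothStep δ₀ δ₀) r * h r + smoothStep δ₀ δ₀ r * deriv h r :=
  (hasDerivAt_originCut hh r).deriv

/-- `(χ₀ h)' = h'` on `[2δ₀, ∞)`. [folklore] -/
theorem deriv_originCut_of_ge (hh : ContDiff ℝ 1 h) (hδ : 0 < δ₀) {r : ℝ} (hr : 2 * δ₀ ≤ r) :
    deriv (originCut δ₀ h) r = deriv h r := by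
  have hr' : δ₀ + δ₀ ≤ r := by linarith
  rw [deriv_originCut hh, deriv_smoothStep_of_ge hδ hr', smoothStep_of_ge hδ hr']; ring

/-- **The origin has zero capacity for the weight `r²`.** For a `C¹` function `h` there is `C`
such that for all `0 < δ₀ ≤ 1/2` the cut-off `χ₀ h` satisfies `∫_{(0, 2δ₀]} r² ((χ₀h)')² ≤ C δ₀`:
`|(χ₀ h)'| ≤ (M‖h‖_∞ + ‖h'‖_∞)/δ₀` while `r² ≤ 4δ₀²` on a layer of length `2δ₀`. [folklore] -/
theorem exists_originCut_bound (hh : ContDiff ℝ 1 h) :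
    ∃ C : ℝ, 0 ≤ C ∧ ∀ δ₀ : ℝ, 0 < δ₀ → δ₀ ≤ 1 / 2 →
      ∫⁻ r in Ioc 0 (2 * δ₀), ENNReal.ofReal (r ^ 2 * deriv (originCut δ₀ h) r ^ 2) ≤
        ENNReal.ofReal (C * δ₀) := by
  obtain ⟨M, hM0, hM⟩ := exists_bound_deriv_smoothTransition
  obtain ⟨H₀, hH₀⟩ := isCompact_Icc.exists_bound_of_continuousOn (s := Icc (0 : ℝ) 1)
    hh.continuous.continuousOn
  obtain ⟨H₁, hH₁⟩ := isCompact_Icc.exists_bound_of_continuousOn (s := Icc (0 : ℝ) 1)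
    ((hh.continuous_deriv le_rfl).continuousOn)
  set K := M * max H₀ 0 + max H₁ 0 with hK
  have hK0 : 0 ≤ K := by positivity
  refine ⟨8 * K ^ 2, by positivity, fun δ₀ hδ hδ1 => ?_⟩
  -- pointwise derivative bound on `(0, 2δ₀]`
  have hpt : ∀ r ∈ Ioc 0 (2 * δ₀), |deriv (originCut δ₀ h) r| ≤ K / δ₀ := by
    intro r hr
    have hr1 : r ∈ Icc (0 : ℝ) 1 := ⟨hr.1.le, by linarith [hr.2]⟩
    rw [deriv_originCut hh]
    have h1 : |deriv (smoothStep δ₀ δ₀) r| ≤ M / δ₀ := by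
      rcases le_or_gt r δ₀ with hr' | hr'
      · rw [deriv_smoothStep_of_le hδ hr', abs_zero]; positivity
      · exact abs_deriv_smoothStep_le hδ hM ⟨hr'.le, by linarith [hr.2]⟩
    have h2 : |h r| ≤ max H₀ 0 := (Real.norm_eq_abs _ ▸ hH₀ r hr1).trans (le_max_left _ _)
    have h3 : |deriv h r| ≤ max H₁ 0 := (Real.norm_eq_abs _ ▸ hH₁ r hr1).trans (le_max_left _ _)
    have h4 : |smoothStep δ₀ δ₀ r| ≤ 1 := by
      rw [abs_of_nonneg (smoothStep_nonneg r)]; exact smoothStep_le_one r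
    calc |deriv (smoothStep δ₀ δ₀) r * h r + smoothStep δ₀ δ₀ r * deriv h r|
        ≤ |deriv (smoothStep δ₀ δ₀) r| * |h r| + |smoothStep δ₀ δ₀ r| * |deriv h r| := by
          rw [← abs_mul, ← abs_mul]; exact abs_add_le _ _
      _ ≤ M / δ₀ * max H₀ 0 + 1 * max H₁ 0 :=
          add_le_add (mul_le_mul h1 h2 (abs_nonneg _) (by positivity))
            (mul_le_mul h4 h3 (abs_nonneg _) zero_le_one)
      _ ≤ K / δ₀ := by
          rw [hK, add_div, one_mul]
          refine add_le_add (le_of_eq (by ring)) ?_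
          exact le_div_self (le_max_right _ _) hδ (by linarith)
  calc ∫⁻ r in Ioc 0 (2 * δ₀), ENNReal.ofReal (r ^ 2 * deriv (originCut δ₀ h) r ^ 2)
      ≤ ∫⁻ _ in Ioc 0 (2 * δ₀), ENNReal.ofReal (4 * K ^ 2) := by
        refine setLIntegral_mono' measurableSet_Ioc fun r hr => ENNReal.ofReal_le_ofReal ?_
        have h1 : r ^ 2 ≤ (2 * δ₀) ^ 2 := pow_le_pow_left₀ hr.1.le hr.2 2
        have h2 : deriv (originCut δ₀ h) r ^ 2 ≤ (K / δ₀) ^ 2 := by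
          rw [← sq_abs]; exact pow_le_pow_left₀ (abs_nonneg _) (hpt r hr) 2
        calc r ^ 2 * deriv (originCut δ₀ h) r ^ 2 ≤ (2 * δ₀) ^ 2 * (K / δ₀) ^ 2 :=
              mul_le_mul h1 h2 (sq_nonneg _) (by positivity)
          _ = 4 * K ^ 2 := by field_simp; ring
    _ = ENNReal.ofReal (8 * K ^ 2 * δ₀) := by
        rw [setLIntegral_const, Real.volume_Ioc, sub_zero, ← ENNReal.ofReal_mul (by positivity)]
        congr 1; ring

end OriginCut

/-! ### The harmonic tail -/

section Tail

variable {R₁ b c : ℝ}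

/-- A smooth positive floor: `ρ(r) = r` for `r ≥ R₁/2`, `ρ = R₁/2` for `r ≤ R₁/4`, and
`ρ ≥ R₁/4` throughout (so that `ρ⁻¹` is smooth on all of `ℝ`). [folklore] -/
def posFloor (R₁ : ℝ) (r : ℝ) : ℝ := glue (R₁ / 4) (R₁ / 4) (fun _ => R₁ / 2) id r

/-- The positive floor is `C¹`. [folklore] -/
theorem posFloor_contDiff (R₁ : ℝ) : ContDiff ℝ 1 (posFloor R₁) :=
  glue_contDiff contDiff_const contDiff_id _ _

/-- `ρ(r) = r` for `r ≥ R₁/2`. [folklore] -/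
theorem posFloor_of_ge (hR : 0 < R₁) {r : ℝ} (hr : R₁ / 2 ≤ r) : posFloor R₁ r = r :=
  glue_of_ge (θ := R₁ / 4) (by linarith) (by linarith)

/-- `ρ ≥ R₁/4 > 0`. [folklore] -/
theorem posFloor_pos (hR : 0 < R₁) (r : ℝ) : R₁ / 4 ≤ posFloor R₁ r := by
  unfold posFloor
  rcases le_or_gt (R₁ / 4) r with hr | hr
  · -- convex combination of `R₁/2` and `r ≥ R₁/4`
    rw [glue_eq_add]
    have h0 := smoothStep_nonneg (r₀ := R₁ / 4) (θ := R₁ / 4) r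
    have h1 := smoothStep_le_one (r₀ := R₁ / 4) (θ := R₁ / 4) r
    simp only [id]
    nlinarith
  · rw [glue_of_le (by linarith) hr.le]; linarith

/-- **The harmonic tail** `T(r) = 1 - (1 - c)(r⁻¹ - b⁻¹)/(R₁⁻¹ - b⁻¹)` (for `r ≥ R₁/2`; made
globally `C¹` through the positive floor): the minimiser of `∫ r² T'²` on `[R₁, b]` with
`T(R₁) = c`, `T(b) = 1` [(C.7): `f₀ = 1 - a/r` beyond the range of `v`].
[cite: LSSY2005, App. C, Thm. C.1 (C.7)] -/
def tailFun (R₁ b c : ℝ) (r : ℝ) : ℝ := 1 - (1 - c) * ((posFloor R₁ r)⁻¹ - b⁻¹) / (R₁⁻¹ - b⁻¹)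

/-- `κ = (R₁⁻¹ - b⁻¹)⁻¹`, the capacity of the annulus `R₁ < r < b` (per unit solid angle): the
minimum of `∫_{R₁}^b r² T'² dr` over `T(R₁) = 0`, `T(b) = 1`. [cite: LSSY2005, App. C, (C.8)] -/
def annulusCap (R₁ b : ℝ) : ℝ := (R₁⁻¹ - b⁻¹)⁻¹

/-- `R₁⁻¹ - b⁻¹ > 0` for `0 < R₁ < b`. [folklore] -/
theorem inv_sub_inv_pos (hR : 0 < R₁) (hb : R₁ < b) : 0 < R₁⁻¹ - b⁻¹ := by
  rw [sub_pos]; exact inv_strictAnti₀ hR hb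

/-- `κ > 0`. [folklore] -/
theorem annulusCap_pos (hR : 0 < R₁) (hb : R₁ < b) : 0 < annulusCap R₁ b :=
  inv_pos.mpr (inv_sub_inv_pos hR hb)

/-- `κ ≤ 2R₁` once `b ≥ 2R₁`. [folklore] -/
theorem annulusCap_le (hR : 0 < R₁) (hb : 2 * R₁ ≤ b) : annulusCap R₁ b ≤ 2 * R₁ := by
  have hb0 : 0 < b := by linarith
  rw [annulusCap, inv_le_comm₀ (inv_sub_inv_pos hR (by linarith)) (by positivity), le_sub_comm,
    inv_le_comm₀ hb0 (by rw [sub_pos]; exact inv_strictAnti₀ (by positivity) (by linarith))]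
  have : R₁⁻¹ - (2 * R₁)⁻¹ = (2 * R₁)⁻¹ := by field_simp; ring
  rw [this, inv_inv]
  exact hb

/-- The (globalised) harmonic tail is `C¹` on `ℝ`. [folklore] -/
theorem tailFun_contDiff (hR : 0 < R₁) (b c : ℝ) : ContDiff ℝ 1 (tailFun R₁ b c) := by
  unfold tailFun
  refine contDiff_const.sub ((contDiff_const.mul (((posFloor_contDiff R₁).inv fun r => ?_).sub
    contDiff_const)).div_const _)
  have := posFloor_pos hR r
  exact (show (0 : ℝ) < posFloor R₁ r by linarith).ne'

/-- For `r ≥ R₁/2` the tail is `1 - (1-c)κ(r⁻¹ - b⁻¹)`. [cite: LSSY2005, App. C, (C.7)] -/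
theorem tailFun_eq (hR : 0 < R₁) {r : ℝ} (hr : R₁ / 2 ≤ r) :
    tailFun R₁ b c r = 1 - (1 - c) * annulusCap R₁ b * (r⁻¹ - b⁻¹) := by
  rw [tailFun, posFloor_of_ge hR hr, annulusCap, div_eq_mul_inv]; ring

/-- `T(R₁) = c`. [folklore] -/
theorem tailFun_R₁ (hR : 0 < R₁) (hb : R₁ < b) : tailFun R₁ b c R₁ = c := by
  rw [tailFun, posFloor_of_ge hR (by linarith), mul_div_assoc, div_self (inv_sub_inv_pos hR hb).ne']
  ring

/-- `T(b) = 1`. [folklore] -/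
theorem tailFun_b (hR : 0 < R₁) (hb : R₁ < b) : tailFun R₁ b c b = 1 := by
  rw [tailFun, posFloor_of_ge hR (by linarith), sub_self, mul_zero, zero_div, sub_zero]

/-- `1 - T(r) = (1-c)κ(r⁻¹ - b⁻¹)` for `r ≥ R₁/2`. [cite: LSSY2005, App. C, (C.7)] -/
theorem one_sub_tailFun (hR : 0 < R₁) {r : ℝ} (hr : R₁ / 2 ≤ r) :
    1 - tailFun R₁ b c r = (1 - c) * annulusCap R₁ b * (r⁻¹ - b⁻¹) := by
  rw [tailFun_eq hR hr]; ring

/-- `T'(r) = (1-c)κ/r²` for `r > R₁/2`. [cite: LSSY2005, App. C, (C.7)] -/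
theorem hasDerivAt_tailFun (hR : 0 < R₁) {r : ℝ} (hr : R₁ / 2 < r) :
    HasDerivAt (tailFun R₁ b c) ((1 - c) * annulusCap R₁ b / r ^ 2) r := by
  have hr0 : r ≠ 0 := (show (0 : ℝ) < r by linarith).ne'
  have hev : tailFun R₁ b c =ᶠ[𝓝 r] fun r => 1 - (1 - c) * annulusCap R₁ b * (r⁻¹ - b⁻¹) := by
    filter_upwards [Ioi_mem_nhds hr] with s hs
    exact tailFun_eq hR hs.le
  refine HasDerivAt.congr_of_eventuallyEq ?_ hev
  have h1 : HasDerivAt (fun r : ℝ => r⁻¹ - b⁻¹) (-(r ^ 2)⁻¹) r := by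
    simpa using (hasDerivAt_inv hr0).sub_const b⁻¹
  have h2 := (h1.const_mul ((1 - c) * annulusCap R₁ b)).const_sub 1
  convert h2 using 1
  field_simp

/-- `T'(r) = (1-c)κ/r²` for `r > R₁/2`. [cite: LSSY2005, App. C, (C.7)] -/
theorem deriv_tailFun (hR : 0 < R₁) {r : ℝ} (hr : R₁ / 2 < r) :
    deriv (tailFun R₁ b c) r = (1 - c) * annulusCap R₁ b / r ^ 2 :=
  (hasDerivAt_tailFun hR hr).deriv

/-- On `[R₁, b]` the tail lies between `c` and `1` (for `c ≤ 1`). [folklore] -/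
theorem tailFun_mem (hR : 0 < R₁) (hb : R₁ < b) (hc : c ≤ 1) {r : ℝ} (hr : r ∈ Icc R₁ b) :
    c ≤ tailFun R₁ b c r ∧ tailFun R₁ b c r ≤ 1 := by
  have hr0 : 0 < r := hR.trans_le hr.1
  have hb0 : 0 < b := hR.trans hb
  have hκ := annulusCap_pos hR hb
  rw [tailFun_eq hR (by linarith [hr.1])]
  have h1 : 0 ≤ r⁻¹ - b⁻¹ := sub_nonneg.mpr (inv_anti₀ hr0 hr.2)
  have h2 : annulusCap R₁ b * (r⁻¹ - b⁻¹) ≤ 1 := by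
    rw [annulusCap, inv_mul_le_iff₀ (inv_sub_inv_pos hR hb), mul_one]
    exact sub_le_sub_right (inv_anti₀ hR hr.1) _
  constructor
  · nlinarith [mul_nonneg (sub_nonneg.mpr hc) (mul_nonneg hκ.le h1)]
  · nlinarith [mul_nonneg (sub_nonneg.mpr hc) (mul_nonneg hκ.le h1)]

/-- **Energy of the tail**: `∫_{(R₁, b]} r² T'(r)² dr = (1 - c)² κ`. [cite: LSSY2005, App. C, (C.8)] -/
theorem lintegral_tail_sq (hR : 0 < R₁) (hb : R₁ < b) :
    ∫⁻ r in Ioc R₁ b, ENNReal.ofReal (r ^ 2 * deriv (tailFun R₁ b c) r ^ 2) =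
      ENNReal.ofReal ((1 - c) ^ 2 * annulusCap R₁ b) := by
  have hκ := annulusCap_pos hR hb
  calc ∫⁻ r in Ioc R₁ b, ENNReal.ofReal (r ^ 2 * deriv (tailFun R₁ b c) r ^ 2)
      = ∫⁻ r in Ioc R₁ b, ENNReal.ofReal (((1 - c) * annulusCap R₁ b) ^ 2) *
          ENNReal.ofReal ((r ^ 2)⁻¹) := by
        refine setLIntegral_congr_fun measurableSet_Ioc fun r hr => ?_
        have hr0 : 0 < r := hR.trans hr.1
        rw [deriv_tailFun hR (by linarith [hr.1]), ← ENNReal.ofReal_mul (sq_nonneg _)]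
        congr 1
        field_simp
    _ = ENNReal.ofReal (((1 - c) * annulusCap R₁ b) ^ 2) * ENNReal.ofReal (1 / R₁ - 1 / b) := by
        rw [lintegral_const_mul' _ _ ENNReal.ofReal_ne_top, lintegral_inv_sq hR hb.le]
    _ = ENNReal.ofReal ((1 - c) ^ 2 * annulusCap R₁ b) := by
        rw [← ENNReal.ofReal_mul (sq_nonneg _)]
        congr 1
        have hd := (inv_sub_inv_pos hR hb).ne'
        rw [annulusCap, one_div, one_div]
        field_simp

end Tail

/-! ### The optimisation of the junction value (series combination of capacities) -/

section Harmonic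

/-- `t ↦ t b/(b - t)` is non-decreasing on `t < b` (`b > 0`). [folklore] -/
theorem mul_div_sub_mono {b t e : ℝ} (hte : t ≤ e) (heb : e < b) :
    t * b / (b - t) ≤ e * b / (b - e) := by
  rw [div_le_div_iff₀ (by linarith) (by linarith)]
  have h : e * b * (b - t) - t * b * (b - e) = b ^ 2 * (e - t) := by ring
  nlinarith [mul_nonneg (sq_nonneg b) (sub_nonneg.mpr hte)]

/-- `k + (1 - c)² R ≥ k R/(k + c² R)`: the energy of inner part plus annulus is at least the
series combination (`(k - c(1-c)R)² ≥ 0`). [folklore] -/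
theorem harmonic_le_add {k c R : ℝ} (hD : 0 < k + c ^ 2 * R) :
    k * R / (k + c ^ 2 * R) ≤ k + (1 - c) ^ 2 * R := by
  rw [div_le_iff₀ hD]
  nlinarith [sq_nonneg (k - c * (1 - c) * R)]

/-- **Series combination of the inner energy and the annulus** [(C.8) in variational form]. Let
`k ≥ 0` (inner energy at junction value `c`), `0 < R₁ < b`, `κ = (R₁⁻¹ - b⁻¹)⁻¹`, and suppose the
total energy `e` of a competitor satisfies `k + (1-c)² R₁ ≤ e < b`. With the optimal scale
`λ = cκ/(k + c²κ)` the profile "`λ ×` inner part, then harmonic tail from `λc` to `1`" has energy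
`λ²k + (1 - λc)²κ ≤ e b/(b - e)`; moreover `(1 - λc)κ ≤ eb/(b - e)` and `0 ≤ λc ≤ 1`.
[cite: LSSY2005, App. C, Thm. C.1 (C.8)] -/
theorem harmonic_comparison {k c R₁ b e : ℝ} (hk : 0 ≤ k) (hR : 0 < R₁) (hb : R₁ < b)
    (he : k + (1 - c) ^ 2 * R₁ ≤ e) (heb : e < b) :
    (c * annulusCap R₁ b / (k + c ^ 2 * annulusCap R₁ b)) ^ 2 * k +
        (1 - c * annulusCap R₁ b / (k + c ^ 2 * annulusCap R₁ b) * c) ^ 2 * annulusCap R₁ b ≤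
      e * b / (b - e) ∧
    (1 - c * annulusCap R₁ b / (k + c ^ 2 * annulusCap R₁ b) * c) * annulusCap R₁ b ≤
      e * b / (b - e) ∧
    0 ≤ c * annulusCap R₁ b / (k + c ^ 2 * annulusCap R₁ b) * c ∧
    c * annulusCap R₁ b / (k + c ^ 2 * annulusCap R₁ b) * c ≤ 1 := by
  set κ := annulusCap R₁ b with hκ_def
  have hκ : 0 < κ := annulusCap_pos hR hb
  have hb0 : 0 < b := hR.trans hb
  have he0 : 0 ≤ e := le_trans (by positivity) he
  have hκe : κ = R₁ * b / (b - R₁) := by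
    have h1 : R₁⁻¹ - b⁻¹ = (b - R₁) / (R₁ * b) := by
      field_simp
    rw [hκ_def, annulusCap, h1, inv_div]
  -- the capacity of the annulus alone is admissible (`e ≥ R₁` would be needed; used when `D = 0`)
  rcases eq_or_lt_of_le (show 0 ≤ k + c ^ 2 * κ by positivity) with hD | hD
  · -- degenerate case `k = 0`, `c = 0`: `λ = 0`, the profile is the bare tail
    have hk0 : k = 0 := by nlinarith [sq_nonneg c, mul_nonneg (sq_nonneg c) hκ.le]
    have hc0 : c ^ 2 * κ = 0 := by linarith
    have hc : c = 0 := by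
      rcases mul_eq_zero.mp hc0 with h | h
      · exact pow_eq_zero_iff (two_ne_zero) |>.mp h
      · exact absurd h hκ.ne'
    subst hk0; subst hc
    simp only [zero_mul, zero_div, mul_zero, sub_zero, one_pow, one_mul, zero_pow two_ne_zero,
      zero_add, le_refl, zero_le_one, and_true, and_self]
    have hR₁e : R₁ ≤ e := by simpa using he
    rw [hκe]
    exact mul_div_sub_mono hR₁e heb
  · -- generic case
    have hlc : c * κ / (k + c ^ 2 * κ) * c = c ^ 2 * κ / (k + c ^ 2 * κ) := by
      field_simp
    have h1lc : 1 - c * κ / (k + c ^ 2 * κ) * c = k / (k + c ^ 2 * κ) := by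
      rw [hlc]; field_simp; ring
    have hval : (c * κ / (k + c ^ 2 * κ)) ^ 2 * k + (1 - c * κ / (k + c ^ 2 * κ) * c) ^ 2 * κ =
        k * κ / (k + c ^ 2 * κ) := by
      rw [h1lc]; field_simp; ring
    have hval2 : (1 - c * κ / (k + c ^ 2 * κ) * c) * κ = k * κ / (k + c ^ 2 * κ) := by
      rw [h1lc]; field_simp
    -- `kκ/(k + c²κ) ≤ eb/(b-e)`
    have hmain : k * κ / (k + c ^ 2 * κ) ≤ e * b / (b - e) := by
      rcases eq_or_lt_of_le hk with hk0 | hk0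
      · rw [← hk0]; simp only [zero_mul, zero_div]; positivity
      · have hDR : 0 < k + c ^ 2 * R₁ := by positivity
        set H := k * R₁ / (k + c ^ 2 * R₁) with hH
        have hHe : H ≤ e := (harmonic_le_add hDR).trans he
        have hH0 : 0 ≤ H := by positivity
        have hHR : H ≤ R₁ := by
          rw [hH, div_le_iff₀ hDR]
          have : 0 ≤ c ^ 2 * R₁ * R₁ := by positivity
          nlinarith [this]
        have hHb : H < b := hHR.trans_lt hb
        have hid : k * κ / (k + c ^ 2 * κ) = H * b / (b - H) := by
          rw [hH, hκe]
          have h1 : b - R₁ ≠ 0 := by linarith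
          have h2 : k + c ^ 2 * R₁ ≠ 0 := hDR.ne'
          field_simp
          ring
        rw [hid]
        exact mul_div_sub_mono hHe heb
    refine ⟨hval ▸ hmain, hval2 ▸ hmain, ?_, ?_⟩
    · rw [hlc]; positivity
    · rw [hlc, div_le_one hD]; linarith

end Harmonic

/-! ### Radial functions on `ℝ³` -/

section Radial

open RealInnerProductSpace

variable {g : ℝ → ℝ}

/-- The radial function `x ↦ g(|x|)`. [cite: LSSY2005, Thm. 2.2, proof, (2.15): `f(|x|)`] -/
def radialFun (g : ℝ → ℝ) (x : Space) : ℝ := g ‖x‖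

/-- The derivative of the Euclidean norm away from the origin: `D|x| v = ⟨x, v⟩/|x|`. [folklore] -/
theorem hasFDerivAt_norm_of_ne_zero {x : Space} (hx : x ≠ 0) :
    HasFDerivAt (fun y : Space => ‖y‖) ((‖x‖)⁻¹ • (innerSL ℝ x : Space →L[ℝ] ℝ)) x := by
  have hx2 : ‖x‖ ^ 2 ≠ 0 := pow_ne_zero 2 (norm_ne_zero_iff.mpr hx)
  have h := (hasStrictFDerivAt_norm_sq x).hasFDerivAt.sqrt hx2
  have hx1 : ‖x‖ ≠ 0 := norm_ne_zero_iff.mpr hx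
  have heq : (fun y : Space => √(‖y‖ ^ 2)) = fun y => ‖y‖ := funext fun y => Real.sqrt_sq (norm_nonneg y)
  rw [heq, Real.sqrt_sq (norm_nonneg x), ← Nat.cast_smul_eq_nsmul ℝ (2 : ℕ), smul_smul] at h
  refine h.congr_fderiv ?_
  congr 1
  push_cast
  field_simp

/-- Chain rule for radial functions: `D(g ∘ |·|)(x) v = g'(|x|) ⟨x, v⟩/|x|` for `x ≠ 0`. [folklore] -/
theorem hasFDerivAt_radialFun (hg : Differentiable ℝ g) {x : Space} (hx : x ≠ 0) :
    HasFDerivAt (radialFun g) ((deriv g ‖x‖ * (‖x‖)⁻¹) • (innerSL ℝ x : Space →L[ℝ] ℝ)) x := by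
  have h := ((hg ‖x‖).hasDerivAt).comp_hasFDerivAt x (hasFDerivAt_norm_of_ne_zero hx)
  rw [smul_smul] at h
  exact h

/-- `D(g ∘ |·|)(x) v = g'(|x|) ⟨x, v⟩/|x|` for `x ≠ 0`. [folklore] -/
theorem fderiv_radialFun_apply (hg : Differentiable ℝ g) {x : Space} (hx : x ≠ 0) (v : Space) :
    fderiv ℝ (radialFun g) x v = deriv g ‖x‖ * (‖x‖)⁻¹ * ⟪x, v⟫ := by
  rw [(hasFDerivAt_radialFun hg hx).fderiv]
  simp [innerSL_apply_apply]

/-- `|∇(g ∘ |·|)|²(x) = g'(|x|)²` for `x ≠ 0`. [folklore] -/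
theorem gradSq_radialFun (hg : Differentiable ℝ g) {x : Space} (hx : x ≠ 0) :
    gradSq (radialFun g) x = ENNReal.ofReal (deriv g ‖x‖ ^ 2) := by
  rw [gradSq_eq_ofReal_sum]
  congr 1
  have h1 : ∀ k : Fin 3, fderiv ℝ (radialFun g) x (EuclideanSpace.single k (1 : ℝ)) =
      deriv g ‖x‖ * (‖x‖)⁻¹ * x k := fun k => by
    rw [fderiv_radialFun_apply hg hx, EuclideanSpace.inner_single_right]; simp
  simp_rw [h1, mul_pow, ← Finset.mul_sum, ← EuclideanSpace.real_norm_sq_eq]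
  have hx0 : ‖x‖ ≠ 0 := norm_ne_zero_iff.mpr hx
  field_simp

/-- `∇(g ∘ |·|)(x) = (g'(|x|)/|x|) x` for `x ≠ 0`. [folklore] -/
theorem gradVec_radialFun (hg : Differentiable ℝ g) {x : Space} (hx : x ≠ 0) :
    gradVec (radialFun g) x = (deriv g ‖x‖ * (‖x‖)⁻¹) • x := by
  ext k
  rw [gradVec, PiLp.toLp_apply, PiLp.smul_apply, smul_eq_mul, fderiv_radialFun_apply hg hx,
    EuclideanSpace.inner_single_right]
  simp

/-- `|∇(g ∘ |·|)|(x) = |g'(|x|)|` for `x ≠ 0`. [folklore] -/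
theorem norm_gradVec_radialFun (hg : Differentiable ℝ g) {x : Space} (hx : x ≠ 0) :
    ‖gradVec (radialFun g) x‖ = |deriv g ‖x‖| := by
  have hx0 : ‖x‖ ≠ 0 := norm_ne_zero_iff.mpr hx
  rw [gradVec_radialFun hg hx, norm_smul, Real.norm_eq_abs, abs_mul, abs_inv, abs_norm, mul_assoc,
    inv_mul_cancel₀ hx0, mul_one]

/-- A radial function of a `C¹` profile that is constant near `0` is `C¹` on `ℝ³`. [folklore] -/
theorem radialFun_contDiff (hg : ContDiff ℝ 1 g) {δ : ℝ} (hδ : 0 < δ) (h0 : ∀ r, r ≤ δ → g r = g 0) :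
    ContDiff ℝ 1 (radialFun g) := by
  rw [contDiff_iff_contDiffAt]
  intro x
  by_cases hx : ‖x‖ < δ
  · -- near the origin the function is constant
    have hev : radialFun g =ᶠ[𝓝 x] fun _ => g 0 := by
      filter_upwards [Metric.ball_mem_nhds x (show 0 < δ - ‖x‖ by linarith)] with y hy
      refine h0 _ ?_
      rw [mem_ball, dist_eq_norm] at hy
      have := norm_le_norm_add_norm_sub' y x
      rw [norm_sub_rev] at hy
      linarith [norm_sub_rev x y, norm_le_insert' x y]
    exact contDiffAt_const.congr_of_eventuallyEq hev
  · have hx0 : x ≠ 0 := fun h => hx (by rw [h, norm_zero]; exact hδ)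
    exact hg.contDiffAt.comp x (contDiffAt_norm ℝ hx0)

/-- `x ↦ g(|x|)` is even. [folklore] -/
theorem radialFun_neg (x : Space) : radialFun g (-x) = radialFun g x := by simp [radialFun]

/-- **The three integrals of a radial profile** in terms of the profile. Energy:
`E₁ = 2𝓔[g ∘ |·|] = 8π ∫_0^∞ r²(g'² + ½ v g²) dr`. [cite: LSSY2005, Thm. 2.2, proof, (2.27)] -/
theorem profileEnergy_radialFun (hg : ContDiff ℝ 1 g) {v : ℝ → ℝ≥0∞} (hv : Measurable v) :
    profileEnergy v (radialFun g) =
      2 * (ENNReal.ofReal (4 * Real.pi) * ∫⁻ r in Ioi (0 : ℝ), rayDensity v g r) := by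
  have hgd := hg.differentiable (by norm_num)
  set F : ℝ → ℝ≥0∞ := fun r => ENNReal.ofReal (deriv g r ^ 2) + 2⁻¹ * v r * ENNReal.ofReal (g r ^ 2)
    with hF
  have hFm : Measurable F := ((measurable_deriv g).pow_const 2).ennreal_ofReal.add
    ((measurable_const.mul hv).mul (hg.continuous.measurable.pow_const 2).ennreal_ofReal)
  have hae : (fun x : Space => gradSq (radialFun g) x + 2⁻¹ * v ‖x‖ *
      ((‖radialFun g x‖₊ : ℝ≥0∞)) ^ 2) =ᵐ[volume] fun x => F ‖x‖ := by
    have h0 : ∀ᵐ x : Space ∂volume, x ≠ 0 := by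
      rw [ae_iff]; simp only [ne_eq, not_not, setOf_eq_eq_singleton, measure_singleton]
    filter_upwards [h0] with x hx
    rw [hF, gradSq_radialFun hgd hx, ennnorm_sq_eq_ofReal_sq]; rfl
  rw [profileEnergy, scatteringFunctional, lintegral_congr_ae hae, lintegral_comp_norm_eq_sphere hFm]
  rfl

/-- Volume defect: `I = 4π ∫_0^∞ r²(1 - g²) dr`. [cite: LSSY2005, Thm. 2.2, proof, (2.29)] -/
theorem profileDefect_radialFun (hg : Continuous g) :
    profileDefect (radialFun g) =
      ENNReal.ofReal (4 * Real.pi) * ∫⁻ r in Ioi (0 : ℝ), ENNReal.ofReal (r ^ 2) * ENNReal.ofReal (1 - g r ^ 2) := by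
  rw [profileDefect]
  exact lintegral_comp_norm_eq_sphere (F := fun r => ENNReal.ofReal (1 - g r ^ 2))
    ((continuous_const.sub (hg.pow 2)).measurable.ennreal_ofReal)

/-- `K = 4π ∫_0^∞ r² g |g'| dr`. [cite: LSSY2005, Thm. 2.2, proof, (2.31)–(2.32)] -/
theorem profileK_radialFun (hg : ContDiff ℝ 1 g) :
    profileK (radialFun g) = ENNReal.ofReal (4 * Real.pi) *
      ∫⁻ r in Ioi (0 : ℝ), ENNReal.ofReal (r ^ 2) * ENNReal.ofReal (g r * |deriv g r|) := by
  have hgd := hg.differentiable (by norm_num)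
  have hae : (fun x : Space => ENNReal.ofReal (radialFun g x * ‖gradVec (radialFun g) x‖)) =ᵐ[volume]
      fun x => ENNReal.ofReal (g ‖x‖ * |deriv g ‖x‖|) := by
    have h0 : ∀ᵐ x : Space ∂volume, x ≠ 0 := by
      rw [ae_iff]; simp only [ne_eq, not_not, setOf_eq_eq_singleton, measure_singleton]
    filter_upwards [h0] with x hx
    rw [norm_gradVec_radialFun hgd hx]; rfl
  rw [profileK, lintegral_congr_ae hae]
  exact lintegral_comp_norm_eq_sphere (F := fun r => ENNReal.ofReal (g r * |deriv g r|))
    ((hg.continuous.mul (hg.continuous_deriv le_rfl).abs).measurable.ennreal_ofReal)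

end Radial

/-! ### The glued one-dimensional profile -/

section Profile

variable {R₁ b θ₁ θ₂ c : ℝ} {W : ℝ → ℝ}

/-- The outer part: the harmonic tail glued to the constant `1` across `[b - θ₂, b]`.
[cite: LSSY2005, Thm. 2.2, proof, (2.18)] -/
def outerG (R₁ b θ₂ c : ℝ) : ℝ → ℝ := glue (b - θ₂) θ₂ (tailFun R₁ b c) (fun _ => 1)

/-- **The trial profile** (one-dimensional): inner part `W` on `[0, R₁]`, glued across
`[R₁, R₁ + θ₁]` to the harmonic tail, which is glued across `[b - θ₂, b]` to `1`
[(2.17)–(2.18): `f = f₀/f₀(b)` on `[0, b]`, `1` beyond; here with `C¹` junctions].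
[cite: LSSY2005, Thm. 2.2, proof, (2.17)–(2.18)] -/
def dysonG (R₁ b θ₁ θ₂ c : ℝ) (W : ℝ → ℝ) : ℝ → ℝ := glue R₁ θ₁ W (outerG R₁ b θ₂ c)

/-- The outer part is `C¹`. [folklore] -/
theorem outerG_contDiff (hR : 0 < R₁) (b θ₂ c : ℝ) : ContDiff ℝ 1 (outerG R₁ b θ₂ c) :=
  glue_contDiff (tailFun_contDiff hR b c) contDiff_const _ _

/-- The profile is `C¹` (for a `C¹` inner part). [folklore] -/
theorem dysonG_contDiff (hR : 0 < R₁) (hW : ContDiff ℝ 1 W) (b θ₁ θ₂ c : ℝ) :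
    ContDiff ℝ 1 (dysonG R₁ b θ₁ θ₂ c W) :=
  glue_contDiff hW (outerG_contDiff hR b θ₂ c) _ _

/-- Below `b - θ₂` the outer part is the tail. [folklore] -/
theorem outerG_of_le (hθ₂ : 0 < θ₂) {r : ℝ} (hr : r ≤ b - θ₂) : outerG R₁ b θ₂ c r = tailFun R₁ b c r :=
  glue_of_le hθ₂ hr

/-- Beyond `b` the outer part is `1`. [folklore] -/
theorem outerG_of_ge (hθ₂ : 0 < θ₂) {r : ℝ} (hr : b ≤ r) : outerG R₁ b θ₂ c r = 1 :=
  glue_of_ge hθ₂ (by linarith)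

/-- Below `b - θ₂` the derivative of the outer part is `T'`. [folklore] -/
theorem deriv_outerG_of_le (hR : 0 < R₁) (hθ₂ : 0 < θ₂) {r : ℝ} (hr : r ≤ b - θ₂) :
    deriv (outerG R₁ b θ₂ c) r = deriv (tailFun R₁ b c) r :=
  deriv_glue_of_le (tailFun_contDiff hR b c) contDiff_const hθ₂ hr

/-- Beyond `b` the derivative of the outer part vanishes. [folklore] -/
theorem deriv_outerG_of_ge (hR : 0 < R₁) (hθ₂ : 0 < θ₂) {r : ℝ} (hr : b ≤ r) :
    deriv (outerG R₁ b θ₂ c) r = 0 := by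
  rw [outerG, deriv_glue_of_ge (tailFun_contDiff hR b c) contDiff_const hθ₂ (by linarith)]
  exact deriv_const r 1

/-- On `[R₁, ∞)` the outer part lies in `[c, 1]` and dominates the tail up to `b`. [folklore] -/
theorem outerG_mem (hR : 0 < R₁) (hb : R₁ < b) (hθ₂ : 0 < θ₂) (hc1 : c ≤ 1) {r : ℝ}
    (hr : R₁ ≤ r) : c ≤ outerG R₁ b θ₂ c r ∧ outerG R₁ b θ₂ c r ≤ 1 := by
  rcases le_or_gt r b with hrb | hrb
  · have hT := tailFun_mem hR hb hc1 ⟨hr, hrb⟩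
    exact ⟨hT.1.trans (le_glue hT.2), glue_le_one hT.2 le_rfl⟩
  · rw [outerG_of_ge hθ₂ hrb.le]; exact ⟨hc1, le_rfl⟩

/-- On `[R₁, b]` the outer part dominates the tail. [folklore] -/
theorem tailFun_le_outerG (hR : 0 < R₁) (hb : R₁ < b) (hc1 : c ≤ 1) {r : ℝ} (hr : r ∈ Icc R₁ b) :
    tailFun R₁ b c r ≤ outerG R₁ b θ₂ c r :=
  le_glue (tailFun_mem hR hb hc1 hr).2

/-- Below `R₁` the profile is the inner part `W`. [folklore] -/
theorem dysonG_of_le (hθ₁ : 0 < θ₁) {r : ℝ} (hr : r ≤ R₁) : dysonG R₁ b θ₁ θ₂ c W r = W r :=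
  glue_of_le hθ₁ hr

/-- Below `R₁` the derivative of the profile is `W'`. [folklore] -/
theorem deriv_dysonG_of_le (hR : 0 < R₁) (hW : ContDiff ℝ 1 W) (hθ₁ : 0 < θ₁) {r : ℝ} (hr : r ≤ R₁) :
    deriv (dysonG R₁ b θ₁ θ₂ c W) r = deriv W r :=
  deriv_glue_of_le hW (outerG_contDiff hR b θ₂ c) hθ₁ hr

/-- Beyond `R₁ + θ₁` the profile is the outer part. [folklore] -/
theorem dysonG_of_ge (hθ₁ : 0 < θ₁) {r : ℝ} (hr : R₁ + θ₁ ≤ r) :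
    dysonG R₁ b θ₁ θ₂ c W r = outerG R₁ b θ₂ c r :=
  glue_of_ge hθ₁ hr

/-- Beyond `R₁ + θ₁` the derivative of the profile is that of the outer part. [folklore] -/
theorem deriv_dysonG_of_ge (hR : 0 < R₁) (hW : ContDiff ℝ 1 W) (hθ₁ : 0 < θ₁) {r : ℝ}
    (hr : R₁ + θ₁ ≤ r) : deriv (dysonG R₁ b θ₁ θ₂ c W) r = deriv (outerG R₁ b θ₂ c) r :=
  deriv_glue_of_ge hW (outerG_contDiff hR b θ₂ c) hθ₁ hr

/-- In the tail region the profile is the harmonic tail. [folklore] -/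
theorem dysonG_tail (hR : 0 < R₁) (hW : ContDiff ℝ 1 W) (hθ₁ : 0 < θ₁) (hθ₂ : 0 < θ₂) {r : ℝ}
    (hr1 : R₁ + θ₁ ≤ r) (hr2 : r ≤ b - θ₂) :
    dysonG R₁ b θ₁ θ₂ c W r = tailFun R₁ b c r ∧
      deriv (dysonG R₁ b θ₁ θ₂ c W) r = deriv (tailFun R₁ b c) r := by
  rw [dysonG_of_ge hθ₁ hr1, deriv_dysonG_of_ge hR hW hθ₁ hr1, outerG_of_le hθ₂ hr2,
    deriv_outerG_of_le hR hθ₂ hr2]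
  exact ⟨rfl, rfl⟩

/-- Beyond `b` the profile is `1` with vanishing derivative [(2.18)]. [cite: LSSY2005, Thm. 2.2, proof, (2.18)] -/
theorem dysonG_beyond (hR : 0 < R₁) (hW : ContDiff ℝ 1 W) (hθ₁ : 0 < θ₁) (hθ₂ : 0 < θ₂)
    (hb : R₁ + θ₁ ≤ b) {r : ℝ} (hr : b ≤ r) :
    dysonG R₁ b θ₁ θ₂ c W r = 1 ∧ deriv (dysonG R₁ b θ₁ θ₂ c W) r = 0 := by
  rw [dysonG_of_ge hθ₁ (hb.trans hr), deriv_dysonG_of_ge hR hW hθ₁ (hb.trans hr),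
    outerG_of_ge hθ₂ hr, deriv_outerG_of_ge hR hθ₂ hr]
  exact ⟨rfl, rfl⟩

/-- The profile takes values in `[0, 1]` [(2.17)]. [cite: LSSY2005, Thm. 2.2, proof, (2.17)] -/
theorem dysonG_mem (hR : 0 < R₁) (hb : R₁ < b) (hθ₁ : 0 < θ₁) (hθ₂ : 0 < θ₂) (hc0 : 0 ≤ c)
    (hc1 : c ≤ 1) (hW : ∀ r, 0 ≤ W r ∧ W r ≤ 1) (r : ℝ) :
    0 ≤ dysonG R₁ b θ₁ θ₂ c W r ∧ dysonG R₁ b θ₁ θ₂ c W r ≤ 1 := by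
  rcases le_or_gt r R₁ with hr | hr
  · rw [dysonG_of_le hθ₁ hr]; exact hW r
  · have hO := outerG_mem hR hb hθ₂ hc1 hr.le
    exact ⟨glue_nonneg (hW r).1 (hc0.trans hO.1), glue_le_one (hW r).2 hO.2⟩

/-- On `[R₁ + θ₁, b]` the profile dominates the tail (used for the volume defect). [folklore] -/
theorem tailFun_le_dysonG (hR : 0 < R₁) (hb : R₁ < b) (hθ₁ : 0 < θ₁) (hc1 : c ≤ 1) {r : ℝ}
    (hr1 : R₁ + θ₁ ≤ r) (hr2 : r ≤ b) : tailFun R₁ b c r ≤ dysonG R₁ b θ₁ θ₂ c W r := by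
  rw [dysonG_of_ge hθ₁ hr1]
  exact tailFun_le_outerG hR hb hc1 ⟨by linarith, hr2⟩

end Profile

/-! ### One-dimensional integrals of the profile -/

section ProfileIntegrals

variable {v : ℝ → ℝ≥0∞}

/-- Splitting a lower integral over `(a, ∞)` at `b ≥ a`. [folklore] -/
theorem lintegral_Ioi_eq_add {a b : ℝ} (hab : a ≤ b) (F : ℝ → ℝ≥0∞) :
    ∫⁻ r in Ioi a, F r = (∫⁻ r in Ioc a b, F r) + ∫⁻ r in Ioi b, F r := by
  rw [← Ioc_union_Ioi_eq_Ioi hab, lintegral_union measurableSet_Ioi Ioc_disjoint_Ioi_same]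

/-- Where the potential vanishes the ray density is the weighted squared derivative. [folklore] -/
theorem rayDensity_of_eq_zero {g : ℝ → ℝ} {r : ℝ} (h : v r = 0) :
    rayDensity v g r = ENNReal.ofReal (r ^ 2 * deriv g r ^ 2) := by
  rw [rayDensity, h, mul_zero, zero_mul, add_zero, ENNReal.ofReal_mul (sq_nonneg _)]

/-- The kinetic part is bounded by the ray density. [folklore] -/
theorem ofReal_sq_deriv_le_rayDensity (v : ℝ → ℝ≥0∞) (g : ℝ → ℝ) (r : ℝ) :
    ENNReal.ofReal (r ^ 2 * deriv g r ^ 2) ≤ rayDensity v g r := by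
  rw [rayDensity, ENNReal.ofReal_mul (sq_nonneg _)]
  exact mul_le_mul' le_rfl le_self_add

/-- **Scaling and clamping the inner part**: `e[s_τ(λ f)] ≤ (1+2τ)² λ² e[f]` on any set of radii
(chain rule, `|s_τ'| ≤ 1 + 2τ`, `s_τ(y)² ≤ (1+2τ)² y²`). [folklore] -/
theorem lintegral_rayDensity_clamp_le {f : ℝ → ℝ} (hf : ContDiff ℝ 1 f) {τ : ℝ} (hτ : 0 < τ)
    (lam : ℝ) (s : Set ℝ) :
    ∫⁻ r in s, rayDensity v (fun r => clamp τ (lam * f r)) r ≤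
      ENNReal.ofReal ((1 + 2 * τ) ^ 2 * lam ^ 2) * ∫⁻ r in s, rayDensity v f r := by
  rw [← lintegral_const_mul' _ _ ENNReal.ofReal_ne_top]
  refine lintegral_mono fun r => ?_
  set C := (1 + 2 * τ) ^ 2 * lam ^ 2 with hC
  have hC0 : 0 ≤ C := by positivity
  have hfd := hf.differentiable (by norm_num)
  -- chain rule
  have hd : deriv (fun r => clamp τ (lam * f r)) r = deriv (clamp τ) (lam * f r) * (lam * deriv f r) := by
    have h1 : HasDerivAt (fun r => lam * f r) (lam * deriv f r) r := (hfd r).hasDerivAt.const_mul lam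
    have h2 := ((hasDerivAt_clamp (τ := τ) (lam * f r)).comp r h1).deriv
    rw [← (hasDerivAt_clamp (τ := τ) (lam * f r)).deriv] at h2
    exact h2
  have h1 : deriv (fun r => clamp τ (lam * f r)) r ^ 2 ≤ C * deriv f r ^ 2 := by
    rw [hd, mul_pow, mul_pow, hC]
    have := abs_deriv_clamp_le hτ (lam * f r)
    have h2 : deriv (clamp τ) (lam * f r) ^ 2 ≤ (1 + 2 * τ) ^ 2 := by
      rw [← sq_abs]; exact pow_le_pow_left₀ (abs_nonneg _) this 2
    nlinarith [mul_nonneg (mul_nonneg (sub_nonneg.mpr h2) (sq_nonneg lam)) (sq_nonneg (deriv f r))]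
  have h2 : clamp τ (lam * f r) ^ 2 ≤ C * f r ^ 2 := by
    have := clamp_sq_le hτ (lam * f r)
    rw [hC]; nlinarith [this]
  rw [rayDensity, rayDensity, mul_left_comm]
  refine mul_le_mul' le_rfl ?_
  calc ENNReal.ofReal (deriv (fun r => clamp τ (lam * f r)) r ^ 2) +
        2⁻¹ * v r * ENNReal.ofReal (clamp τ (lam * f r) ^ 2)
      ≤ ENNReal.ofReal (C * deriv f r ^ 2) + 2⁻¹ * v r * ENNReal.ofReal (C * f r ^ 2) :=
        add_le_add (ENNReal.ofReal_le_ofReal h1) (mul_le_mul' le_rfl (ENNReal.ofReal_le_ofReal h2))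
    _ = ENNReal.ofReal C * (ENNReal.ofReal (deriv f r ^ 2) + 2⁻¹ * v r * ENNReal.ofReal (f r ^ 2)) := by
        rw [ENNReal.ofReal_mul hC0, ENNReal.ofReal_mul hC0, mul_add]; ring

/-- **Cutting off the inner part at the origin** costs at most `C δ₀`.
[folklore] -/
theorem lintegral_rayDensity_originCut_le (hv : Measurable v) {h : ℝ → ℝ} (hh : ContDiff ℝ 1 h)
    {δ₀ R₁ : ℝ} (hδ : 0 < δ₀) {C : ℝ}
    (hC : ∫⁻ r in Ioc 0 (2 * δ₀), ENNReal.ofReal (r ^ 2 * deriv (originCut δ₀ h) r ^ 2) ≤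
      ENNReal.ofReal (C * δ₀)) :
    ∫⁻ r in Ioc 0 R₁, rayDensity v (originCut δ₀ h) r ≤
      (∫⁻ r in Ioc 0 R₁, rayDensity v h r) + ENNReal.ofReal (C * δ₀) := by
  set G : ℝ → ℝ≥0∞ := fun r => ENNReal.ofReal (r ^ 2 * deriv (originCut δ₀ h) r ^ 2) with hG
  have hGm : Measurable G :=
    ((measurable_id.pow_const 2).mul ((measurable_deriv _).pow_const 2)).ennreal_ofReal
  have hpt : ∀ r ∈ Ioc 0 R₁, rayDensity v (originCut δ₀ h) r ≤
      rayDensity v h r + (Ioc 0 (2 * δ₀)).indicator G r := by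
    intro r hr
    have hsq : ENNReal.ofReal (originCut δ₀ h r ^ 2) ≤ ENNReal.ofReal (h r ^ 2) :=
      ENNReal.ofReal_le_ofReal (originCut_sq_le r)
    rcases le_or_gt r (2 * δ₀) with hr2 | hr2
    · rw [indicator_of_mem (show r ∈ Ioc 0 (2 * δ₀) from ⟨hr.1, hr2⟩)]
      simp only [hG, rayDensity]
      calc ENNReal.ofReal (r ^ 2) * (ENNReal.ofReal (deriv (originCut δ₀ h) r ^ 2) +
            2⁻¹ * v r * ENNReal.ofReal (originCut δ₀ h r ^ 2))
          = ENNReal.ofReal (r ^ 2 * deriv (originCut δ₀ h) r ^ 2) +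
            ENNReal.ofReal (r ^ 2) * (2⁻¹ * v r * ENNReal.ofReal (originCut δ₀ h r ^ 2)) := by
            rw [mul_add, ENNReal.ofReal_mul (sq_nonneg _)]
        _ ≤ ENNReal.ofReal (r ^ 2 * deriv (originCut δ₀ h) r ^ 2) + ENNReal.ofReal (r ^ 2) *
            (ENNReal.ofReal (deriv h r ^ 2) + 2⁻¹ * v r * ENNReal.ofReal (h r ^ 2)) :=
            add_le_add le_rfl (mul_le_mul' le_rfl ((mul_le_mul' le_rfl hsq).trans le_add_self))
        _ = _ := add_comm _ _
    · rw [indicator_of_notMem (fun h' => (not_le.mpr hr2) h'.2), add_zero, rayDensity, rayDensity,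
        deriv_originCut_of_ge hh hδ hr2.le]
      exact mul_le_mul' le_rfl (add_le_add le_rfl (mul_le_mul' le_rfl hsq))
  calc ∫⁻ r in Ioc 0 R₁, rayDensity v (originCut δ₀ h) r
      ≤ ∫⁻ r in Ioc 0 R₁, rayDensity v h r + (Ioc 0 (2 * δ₀)).indicator G r :=
        setLIntegral_mono' measurableSet_Ioc hpt
    _ = (∫⁻ r in Ioc 0 R₁, rayDensity v h r) + ∫⁻ r in Ioc 0 R₁, (Ioc 0 (2 * δ₀)).indicator G r :=
        lintegral_add_left (measurable_rayDensity hv hh.continuous) _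
    _ ≤ (∫⁻ r in Ioc 0 R₁, rayDensity v h r) + ENNReal.ofReal (C * δ₀) := by
        refine add_le_add le_rfl ?_
        rw [lintegral_indicator measurableSet_Ioc, Measure.restrict_restrict measurableSet_Ioc]
        exact (lintegral_mono_set inter_subset_left).trans hC

/-- **Capacity of the annulus along a ray**: if `h(R') = 1` then
`(1 - h(R₁))² R₁ ≤ ∫_{(R₁, R']} r² h'² dr`. [cite: LSSY2005, App. C, (C.8)] -/
theorem ray_capacity {h : ℝ → ℝ} (hh : ContDiff ℝ 1 h) {R₁ R' : ℝ} (hR : 0 < R₁) (hRR : R₁ ≤ R')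
    (h1 : h R' = 1) :
    ENNReal.ofReal ((1 - h R₁) ^ 2 * R₁) ≤ ∫⁻ r in Ioc R₁ R', ENNReal.ofReal (r ^ 2 * deriv h r ^ 2) := by
  have h0 := sq_sub_le_lintegral_mul hh hR hRR
  rw [h1] at h0
  have hR' : 0 < R' := hR.trans_le hRR
  have hfac : (1 / R₁ - 1 / R') * R₁ ≤ 1 := by
    rw [sub_mul, one_div_mul_cancel hR.ne']
    have : 0 ≤ 1 / R' * R₁ := by positivity
    linarith
  calc ENNReal.ofReal ((1 - h R₁) ^ 2 * R₁)
      = ENNReal.ofReal ((1 - h R₁) ^ 2) * ENNReal.ofReal R₁ := ENNReal.ofReal_mul (sq_nonneg _)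
    _ ≤ (∫⁻ s in Ioc R₁ R', ENNReal.ofReal (s ^ 2 * deriv h s ^ 2)) *
          ENNReal.ofReal (1 / R₁ - 1 / R') * ENNReal.ofReal R₁ := mul_le_mul' h0 le_rfl
    _ ≤ (∫⁻ s in Ioc R₁ R', ENNReal.ofReal (s ^ 2 * deriv h s ^ 2)) * 1 := by
        rw [mul_assoc, ← ENNReal.ofReal_mul (sub_nonneg.mpr (one_div_le_one_div_of_le hR hRR))]
        exact mul_le_mul' le_rfl (ENNReal.ofReal_le_one.mpr hfac)
    _ = _ := mul_one _

/-- If `a < A` then some admissible function has a ray of one-dimensional energy `< A`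
(averaging over the sphere, `σ(S²) = 4π`). [cite: LSSY2005, App. C, Thm. C.1] -/
theorem exists_ray_lt (hv : Measurable v) (ha : scatteringLength v ≠ ⊤) {A : ℝ}
    (hA : (scatteringLength v).toReal < A) :
    ∃ φ : Space → ℝ, IsScatteringTrial φ ∧ (∃ R, ∀ x : Space, R < ‖x‖ → φ x = 1) ∧
      ∃ ω : sphere (0 : Space) 1, rayEnergy v φ ω < ENNReal.ofReal A := by
  have h4 : ENNReal.ofReal (4 * Real.pi) ≠ 0 := by
    rw [ENNReal.ofReal_ne_zero_iff]; positivity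
  have hA0 : 0 < A := lt_of_le_of_lt ENNReal.toReal_nonneg hA
  have ha' : scatteringLength v < ENNReal.ofReal A := by
    rw [← ENNReal.ofReal_toReal ha]; exact (ENNReal.ofReal_lt_ofReal_iff hA0).mpr hA
  have hinf : (⨅ (φ : Space → ℝ) (_ : IsScatteringTrial φ), scatteringFunctional v φ) <
      ENNReal.ofReal (4 * Real.pi) * ENNReal.ofReal A := by
    have h := ENNReal.mul_lt_mul_left h4 ENNReal.ofReal_ne_top ha'
    rwa [scatteringLength, mul_comm, ← mul_assoc, ENNReal.mul_inv_cancel h4 ENNReal.ofReal_ne_top,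
      one_mul, mul_comm] at h
  obtain ⟨φ, hφ⟩ := iInf_lt_iff.mp hinf
  obtain ⟨hφt, hφE⟩ := iInf_lt_iff.mp hφ
  refine ⟨φ, hφt, hφt.exists_eq_one, ?_⟩
  by_contra hall
  push Not at hall
  have h1 : ∫⁻ _ω, ENNReal.ofReal A ∂sphereMeasure ≤ ∫⁻ ω, rayEnergy v φ ω ∂sphereMeasure :=
    lintegral_mono fun ω => hall ω
  rw [lintegral_const, sphereMeasure_univ, mul_comm] at h1
  exact (lt_irrefl _) ((h1.trans (lintegral_rayEnergy_le hφt.1 hv)).trans_lt hφE)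

end ProfileIntegrals

/-! ### The three integrals of the glued profile -/

section ProfileBounds

variable {v : ℝ → ℝ≥0∞} {R₁ b θ₁ θ₂ c : ℝ} {W : ℝ → ℝ}

/-- **Energy of the glued profile**: inner part + first layer + tail + second layer (+ nothing
beyond `b`). [cite: LSSY2005, Thm. 2.2, proof, (2.27)–(2.28); App. C (C.8)] -/
theorem dysonG_energy_le (hv0 : ∀ r, R₁ ≤ r → v r = 0) (hR : 0 < R₁) (hW : ContDiff ℝ 1 W)
    (hθ₁ : 0 < θ₁) (hθ₁1 : θ₁ ≤ 1) (hθ₂ : 0 < θ₂) (hθ₂1 : θ₂ ≤ 1) (hb : R₁ + 2 ≤ b) {C_A : ℝ}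
    (hCA : ∀ r ∈ Icc R₁ (R₁ + θ₁), |deriv (dysonG R₁ b θ₁ θ₂ c W) r| ≤ C_A) {C_B : ℝ}
    (hCB : ∀ r ∈ Icc (b - θ₂) (b - θ₂ + θ₂), |deriv (dysonG R₁ b θ₁ θ₂ c W) r| ≤ C_B) :
    ∫⁻ r in Ioi 0, rayDensity v (dysonG R₁ b θ₁ θ₂ c W) r ≤
      (∫⁻ r in Ioc 0 R₁, rayDensity v W r) + ENNReal.ofReal ((R₁ + 1) ^ 2 * C_A ^ 2 * θ₁) +
        ENNReal.ofReal ((1 - c) ^ 2 * annulusCap R₁ b) +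
        ENNReal.ofReal ((b - θ₂ + 1) ^ 2 * C_B ^ 2 * θ₂) := by
  set g := dysonG R₁ b θ₁ θ₂ c W with hg
  have hsplit : ∫⁻ r in Ioi 0, rayDensity v g r =
      (∫⁻ r in Ioc 0 R₁, rayDensity v g r) + ((∫⁻ r in Ioc R₁ (R₁ + θ₁), rayDensity v g r) +
        ((∫⁻ r in Ioc (R₁ + θ₁) (b - θ₂), rayDensity v g r) +
          ((∫⁻ r in Ioc (b - θ₂) b, rayDensity v g r) + ∫⁻ r in Ioi b, rayDensity v g r))) := by
    rw [lintegral_Ioi_eq_add hR.le, lintegral_Ioi_eq_add (show R₁ ≤ R₁ + θ₁ by linarith),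
      lintegral_Ioi_eq_add (show R₁ + θ₁ ≤ b - θ₂ by linarith),
      lintegral_Ioi_eq_add (show b - θ₂ ≤ b by linarith)]
  rw [hsplit]
  -- P1: inner part
  have hP1 : ∫⁻ r in Ioc 0 R₁, rayDensity v g r = ∫⁻ r in Ioc 0 R₁, rayDensity v W r := by
    refine setLIntegral_congr_fun measurableSet_Ioc fun r hr => ?_
    rw [rayDensity, rayDensity, hg, dysonG_of_le hθ₁ hr.2, deriv_dysonG_of_le hR hW hθ₁ hr.2]
  -- P2: first layer
  have hP2 : ∫⁻ r in Ioc R₁ (R₁ + θ₁), rayDensity v g r ≤ ENNReal.ofReal ((R₁ + 1) ^ 2 * C_A ^ 2 * θ₁) := by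
    calc ∫⁻ r in Ioc R₁ (R₁ + θ₁), rayDensity v g r
        = ∫⁻ r in Ioc R₁ (R₁ + θ₁), ENNReal.ofReal (r ^ 2 * deriv g r ^ 2) :=
          setLIntegral_congr_fun measurableSet_Ioc fun r hr => rayDensity_of_eq_zero (hv0 r hr.1.le)
      _ ≤ _ := layer_lintegral_le hR.le hθ₁ hθ₁1 hCA
  -- P3: tail
  have hP3 : ∫⁻ r in Ioc (R₁ + θ₁) (b - θ₂), rayDensity v g r ≤
      ENNReal.ofReal ((1 - c) ^ 2 * annulusCap R₁ b) := by
    calc ∫⁻ r in Ioc (R₁ + θ₁) (b - θ₂), rayDensity v g r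
        = ∫⁻ r in Ioc (R₁ + θ₁) (b - θ₂), ENNReal.ofReal (r ^ 2 * deriv (tailFun R₁ b c) r ^ 2) := by
          refine setLIntegral_congr_fun measurableSet_Ioc fun r hr => ?_
          rw [rayDensity_of_eq_zero (hv0 r (by linarith [hr.1])), hg,
            (dysonG_tail hR hW hθ₁ hθ₂ hr.1.le hr.2).2]
      _ ≤ ∫⁻ r in Ioc R₁ b, ENNReal.ofReal (r ^ 2 * deriv (tailFun R₁ b c) r ^ 2) :=
          lintegral_mono_set (Ioc_subset_Ioc (by linarith) (by linarith))
      _ = _ := lintegral_tail_sq hR (by linarith)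
  -- P4: second layer
  have hP4 : ∫⁻ r in Ioc (b - θ₂) b, rayDensity v g r ≤
      ENNReal.ofReal ((b - θ₂ + 1) ^ 2 * C_B ^ 2 * θ₂) := by
    have hb' : Ioc (b - θ₂) b = Ioc (b - θ₂) (b - θ₂ + θ₂) := by rw [sub_add_cancel]
    calc ∫⁻ r in Ioc (b - θ₂) b, rayDensity v g r
        = ∫⁻ r in Ioc (b - θ₂) (b - θ₂ + θ₂), ENNReal.ofReal (r ^ 2 * deriv g r ^ 2) := by
          rw [hb']
          exact setLIntegral_congr_fun measurableSet_Ioc fun r hr =>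
            rayDensity_of_eq_zero (hv0 r (by linarith [hr.1]))
      _ ≤ _ := layer_lintegral_le (by linarith) hθ₂ hθ₂1 hCB
  -- P5: beyond `b`
  have hP5 : ∫⁻ r in Ioi b, rayDensity v g r = 0 := by
    rw [setLIntegral_congr_fun measurableSet_Ioi (g := fun _ => 0) fun r hr => ?_, lintegral_zero]
    rw [rayDensity_of_eq_zero (hv0 r (by linarith [mem_Ioi.mp hr])), hg,
      (dysonG_beyond hR hW hθ₁ hθ₂ (by linarith) (le_of_lt hr)).2]
    simp
  rw [hP1, hP5, add_zero, add_assoc, add_assoc]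
  exact add_le_add le_rfl (add_le_add hP2 (add_le_add hP3 hP4))

/-- `r - r²/b ≤ b/4`. [folklore] -/
theorem sub_sq_div_le {r b : ℝ} (hb : 0 < b) : r - r ^ 2 / b ≤ b / 4 := by
  rw [sub_le_iff_le_add, ← sub_le_iff_le_add', le_div_iff₀ hb]
  nlinarith [sq_nonneg (b - 2 * r)]

/-- **Volume defect of the glued profile**: `∫_0^∞ r²(1 - g²) ≤ (R₁+1)³ + (1-c)κ b²/2`
(core by volume, tail by `1 - g² ≤ 2(1 - T)`). [cite: LSSY2005, Thm. 2.2, proof, (2.29)] -/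
theorem dysonG_defect_le (hR : 0 < R₁) (hW : ContDiff ℝ 1 W) (hθ₁ : 0 < θ₁) (hθ₁1 : θ₁ ≤ 1)
    (hθ₂ : 0 < θ₂) (hb : R₁ + 2 ≤ b) (hc0 : 0 ≤ c) (hc1 : c ≤ 1)
    (hW01 : ∀ r, 0 ≤ W r ∧ W r ≤ 1) :
    ∫⁻ r in Ioi 0, ENNReal.ofReal (r ^ 2) * ENNReal.ofReal (1 - dysonG R₁ b θ₁ θ₂ c W r ^ 2) ≤
      ENNReal.ofReal ((R₁ + 1) ^ 3) + ENNReal.ofReal ((1 - c) * annulusCap R₁ b * b ^ 2 / 2) := by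
  set g := dysonG R₁ b θ₁ θ₂ c W with hg
  have hb0 : 0 < b := by linarith
  have hκ : 0 ≤ (1 - c) * annulusCap R₁ b := mul_nonneg (by linarith) (annulusCap_pos hR (by linarith)).le
  rw [lintegral_Ioi_eq_add (show (0 : ℝ) ≤ R₁ + 1 by linarith),
    lintegral_Ioi_eq_add (show R₁ + 1 ≤ b by linarith)]
  have hD1 : ∫⁻ r in Ioc 0 (R₁ + 1), ENNReal.ofReal (r ^ 2) * ENNReal.ofReal (1 - g r ^ 2) ≤
      ENNReal.ofReal ((R₁ + 1) ^ 3) := by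
    calc ∫⁻ r in Ioc 0 (R₁ + 1), ENNReal.ofReal (r ^ 2) * ENNReal.ofReal (1 - g r ^ 2)
        ≤ ∫⁻ _ in Ioc 0 (R₁ + 1), ENNReal.ofReal ((R₁ + 1) ^ 2) := by
          refine setLIntegral_mono' measurableSet_Ioc fun r hr => ?_
          calc ENNReal.ofReal (r ^ 2) * ENNReal.ofReal (1 - g r ^ 2)
              ≤ ENNReal.ofReal ((R₁ + 1) ^ 2) * 1 :=
                mul_le_mul' (ENNReal.ofReal_le_ofReal (pow_le_pow_left₀ hr.1.le hr.2 2))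
                  (ENNReal.ofReal_le_one.mpr (by nlinarith [sq_nonneg (g r)]))
            _ = _ := mul_one _
      _ = ENNReal.ofReal ((R₁ + 1) ^ 3) := by
          rw [setLIntegral_const, Real.volume_Ioc, sub_zero, ← ENNReal.ofReal_mul (sq_nonneg _), ← pow_succ]
  have hD2 : ∫⁻ r in Ioc (R₁ + 1) b, ENNReal.ofReal (r ^ 2) * ENNReal.ofReal (1 - g r ^ 2) ≤
      ENNReal.ofReal ((1 - c) * annulusCap R₁ b * b ^ 2 / 2) := by
    calc ∫⁻ r in Ioc (R₁ + 1) b, ENNReal.ofReal (r ^ 2) * ENNReal.ofReal (1 - g r ^ 2)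
        ≤ ∫⁻ _ in Ioc (R₁ + 1) b, ENNReal.ofReal ((1 - c) * annulusCap R₁ b * b / 2) := by
          refine setLIntegral_mono' measurableSet_Ioc fun r hr => ?_
          have hr0 : 0 < r := by linarith [hr.1]
          have hT : tailFun R₁ b c r ≤ g r := tailFun_le_dysonG hR (by linarith) hθ₁ hc1 (by linarith [hr.1]) hr.2
          have hg1 : g r ≤ 1 := (dysonG_mem hR (by linarith) hθ₁ hθ₂ hc0 hc1 hW01 r).2
          have h1 : 1 - g r ^ 2 ≤ 2 * (1 - tailFun R₁ b c r) := by nlinarith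
          rw [one_sub_tailFun hR (by linarith [hr.1])] at h1
          rw [← ENNReal.ofReal_mul (sq_nonneg _)]
          refine ENNReal.ofReal_le_ofReal ?_
          calc r ^ 2 * (1 - g r ^ 2) ≤ r ^ 2 * (2 * ((1 - c) * annulusCap R₁ b * (r⁻¹ - b⁻¹))) :=
                mul_le_mul_of_nonneg_left h1 (sq_nonneg _)
            _ = 2 * ((1 - c) * annulusCap R₁ b) * (r - r ^ 2 / b) := by field_simp
            _ ≤ 2 * ((1 - c) * annulusCap R₁ b) * (b / 4) :=
                mul_le_mul_of_nonneg_left (sub_sq_div_le hb0) (by positivity)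
            _ = (1 - c) * annulusCap R₁ b * b / 2 := by ring
      _ ≤ ENNReal.ofReal ((1 - c) * annulusCap R₁ b * b ^ 2 / 2) := by
          rw [setLIntegral_const, Real.volume_Ioc]
          calc ENNReal.ofReal ((1 - c) * annulusCap R₁ b * b / 2) * ENNReal.ofReal (b - (R₁ + 1))
              ≤ ENNReal.ofReal ((1 - c) * annulusCap R₁ b * b / 2) * ENNReal.ofReal b :=
                mul_le_mul' le_rfl (ENNReal.ofReal_le_ofReal (by linarith))
            _ = _ := by rw [← ENNReal.ofReal_mul (by positivity)]; congr 1; ring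
  have hD3 : ∫⁻ r in Ioi b, ENNReal.ofReal (r ^ 2) * ENNReal.ofReal (1 - g r ^ 2) = 0 := by
    rw [setLIntegral_congr_fun measurableSet_Ioi (g := fun _ => 0) fun r hr => ?_, lintegral_zero]
    rw [hg, (dysonG_beyond hR hW hθ₁ hθ₂ (by linarith) (le_of_lt hr)).1]
    simp
  rw [hD3, add_zero]
  exact add_le_add hD1 hD2

/-- `|y| ≤ (1 + y²)/2`. [folklore] -/
theorem abs_le_half_one_add_sq (y : ℝ) : |y| ≤ (1 + y ^ 2) / 2 := by
  rcases le_or_gt 0 y with hy | hy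
  · rw [abs_of_nonneg hy]; nlinarith [sq_nonneg (y - 1)]
  · rw [abs_of_neg hy]; nlinarith [sq_nonneg (y + 1)]

/-- **The integral `K` of the glued profile**: `∫_0^∞ r² g|g'| ≤ (R₁+1)³/2 + ½∫_{(0,R₁+1]} r²g'² +
(1-c)κ b + b² C_B θ₂` (core by `|g'| ≤ (1+g'²)/2`, tail exactly, second layer by the derivative
bound). [cite: LSSY2005, Thm. 2.2, proof, (2.31)–(2.32)] -/
theorem dysonG_K_le (hR : 0 < R₁) (hW : ContDiff ℝ 1 W) (hθ₁ : 0 < θ₁) (hθ₁1 : θ₁ ≤ 1)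
    (hθ₂ : 0 < θ₂) (hθ₂1 : θ₂ ≤ 1) (hb : R₁ + 2 ≤ b) (hc0 : 0 ≤ c) (hc1 : c ≤ 1)
    (hW01 : ∀ r, 0 ≤ W r ∧ W r ≤ 1) {C_B : ℝ}
    (hCB : ∀ r ∈ Icc (b - θ₂) (b - θ₂ + θ₂), |deriv (dysonG R₁ b θ₁ θ₂ c W) r| ≤ C_B) :
    ∫⁻ r in Ioi 0, ENNReal.ofReal (r ^ 2) *
        ENNReal.ofReal (dysonG R₁ b θ₁ θ₂ c W r * |deriv (dysonG R₁ b θ₁ θ₂ c W) r|) ≤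
      ENNReal.ofReal ((R₁ + 1) ^ 3 / 2) +
        2⁻¹ * (∫⁻ r in Ioc 0 (R₁ + 1), ENNReal.ofReal (r ^ 2 * deriv (dysonG R₁ b θ₁ θ₂ c W) r ^ 2)) +
        ENNReal.ofReal ((1 - c) * annulusCap R₁ b * b) + ENNReal.ofReal (b ^ 2 * C_B * θ₂) := by
  set g := dysonG R₁ b θ₁ θ₂ c W with hg
  have hb0 : 0 < b := by linarith
  have hκ : 0 ≤ (1 - c) * annulusCap R₁ b := mul_nonneg (by linarith) (annulusCap_pos hR (by linarith)).le
  have hg01 := dysonG_mem hR (show R₁ < b by linarith) hθ₁ hθ₂ hc0 hc1 hW01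
  have hCB0 : 0 ≤ C_B := (abs_nonneg _).trans (hCB (b - θ₂) (left_mem_Icc.mpr (by linarith)))
  rw [lintegral_Ioi_eq_add (show (0 : ℝ) ≤ R₁ + 1 by linarith),
    lintegral_Ioi_eq_add (show R₁ + 1 ≤ b - θ₂ by linarith),
    lintegral_Ioi_eq_add (show b - θ₂ ≤ b by linarith)]
  -- K1
  have hK1 : ∫⁻ r in Ioc 0 (R₁ + 1), ENNReal.ofReal (r ^ 2) * ENNReal.ofReal (g r * |deriv g r|) ≤
      ENNReal.ofReal ((R₁ + 1) ^ 3 / 2) +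
        2⁻¹ * ∫⁻ r in Ioc 0 (R₁ + 1), ENNReal.ofReal (r ^ 2 * deriv g r ^ 2) := by
    have hm : Measurable fun r : ℝ => ENNReal.ofReal (r ^ 2 * deriv g r ^ 2) :=
      ((measurable_id.pow_const 2).mul ((measurable_deriv _).pow_const 2)).ennreal_ofReal
    calc ∫⁻ r in Ioc 0 (R₁ + 1), ENNReal.ofReal (r ^ 2) * ENNReal.ofReal (g r * |deriv g r|)
        ≤ ∫⁻ r in Ioc 0 (R₁ + 1), ENNReal.ofReal ((R₁ + 1) ^ 2 / 2) +
            2⁻¹ * ENNReal.ofReal (r ^ 2 * deriv g r ^ 2) := by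
          refine setLIntegral_mono' measurableSet_Ioc fun r hr => ?_
          have h1 : g r * |deriv g r| ≤ (1 + deriv g r ^ 2) / 2 :=
            (mul_le_of_le_one_left (abs_nonneg _) (hg01 r).2).trans (abs_le_half_one_add_sq _)
          have h2 : r ^ 2 ≤ (R₁ + 1) ^ 2 := pow_le_pow_left₀ hr.1.le hr.2 2
          rw [← ENNReal.ofReal_mul (sq_nonneg _)]
          calc ENNReal.ofReal (r ^ 2 * (g r * |deriv g r|))
              ≤ ENNReal.ofReal ((R₁ + 1) ^ 2 / 2 + 2⁻¹ * (r ^ 2 * deriv g r ^ 2)) := by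
                refine ENNReal.ofReal_le_ofReal ?_
                calc r ^ 2 * (g r * |deriv g r|) ≤ r ^ 2 * ((1 + deriv g r ^ 2) / 2) :=
                      mul_le_mul_of_nonneg_left h1 (sq_nonneg _)
                  _ = r ^ 2 / 2 + 2⁻¹ * (r ^ 2 * deriv g r ^ 2) := by ring
                  _ ≤ _ := by linarith
            _ = _ := by
                rw [ENNReal.ofReal_add (by positivity) (by positivity), ENNReal.ofReal_mul (by norm_num),
                  ENNReal.ofReal_inv_of_pos two_pos, ENNReal.ofReal_ofNat]
      _ = _ := by
          rw [lintegral_add_left measurable_const, setLIntegral_const, Real.volume_Ioc, sub_zero,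
            ← ENNReal.ofReal_mul (by positivity), lintegral_const_mul _ hm]
          congr 2; ring
  -- K2
  have hK2 : ∫⁻ r in Ioc (R₁ + 1) (b - θ₂), ENNReal.ofReal (r ^ 2) * ENNReal.ofReal (g r * |deriv g r|) ≤
      ENNReal.ofReal ((1 - c) * annulusCap R₁ b * b) := by
    calc ∫⁻ r in Ioc (R₁ + 1) (b - θ₂), ENNReal.ofReal (r ^ 2) * ENNReal.ofReal (g r * |deriv g r|)
        ≤ ∫⁻ _ in Ioc (R₁ + 1) (b - θ₂), ENNReal.ofReal ((1 - c) * annulusCap R₁ b) := by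
          refine setLIntegral_mono' measurableSet_Ioc fun r hr => ?_
          have hr0 : 0 < r := by linarith [hr.1]
          have hT := dysonG_tail hR hW hθ₁ hθ₂ (c := c) (b := b) (show R₁ + θ₁ ≤ r by linarith [hr.1]) hr.2
          rw [← hg] at hT
          rw [hT.2, deriv_tailFun hR (by linarith [hr.1]), ← ENNReal.ofReal_mul (sq_nonneg _)]
          refine ENNReal.ofReal_le_ofReal ?_
          rw [abs_of_nonneg (by positivity)]
          calc r ^ 2 * (g r * ((1 - c) * annulusCap R₁ b / r ^ 2))
              = g r * ((1 - c) * annulusCap R₁ b) := by field_simp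
            _ ≤ 1 * ((1 - c) * annulusCap R₁ b) := mul_le_mul_of_nonneg_right (hg01 r).2 hκ
            _ = _ := one_mul _
      _ ≤ _ := by
          rw [setLIntegral_const, Real.volume_Ioc]
          calc ENNReal.ofReal ((1 - c) * annulusCap R₁ b) * ENNReal.ofReal (b - θ₂ - (R₁ + 1))
              ≤ ENNReal.ofReal ((1 - c) * annulusCap R₁ b) * ENNReal.ofReal b :=
                mul_le_mul' le_rfl (ENNReal.ofReal_le_ofReal (by linarith))
            _ = _ := by rw [← ENNReal.ofReal_mul hκ]
  -- K3
  have hK3 : ∫⁻ r in Ioc (b - θ₂) b, ENNReal.ofReal (r ^ 2) * ENNReal.ofReal (g r * |deriv g r|) ≤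
      ENNReal.ofReal (b ^ 2 * C_B * θ₂) := by
    calc ∫⁻ r in Ioc (b - θ₂) b, ENNReal.ofReal (r ^ 2) * ENNReal.ofReal (g r * |deriv g r|)
        ≤ ∫⁻ _ in Ioc (b - θ₂) b, ENNReal.ofReal (b ^ 2 * C_B) := by
          refine setLIntegral_mono' measurableSet_Ioc fun r hr => ?_
          have hr0 : 0 ≤ r := by linarith [hr.1]
          rw [← ENNReal.ofReal_mul (sq_nonneg _)]
          refine ENNReal.ofReal_le_ofReal (mul_le_mul (pow_le_pow_left₀ hr0 hr.2 2) ?_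
            (mul_nonneg (hg01 r).1 (abs_nonneg _)) (sq_nonneg _))
          calc g r * |deriv g r| ≤ 1 * C_B :=
                mul_le_mul (hg01 r).2 (hCB r ⟨hr.1.le, by linarith [hr.2]⟩) (abs_nonneg _) zero_le_one
            _ = C_B := one_mul _
      _ = _ := by
          rw [setLIntegral_const, Real.volume_Ioc, ← ENNReal.ofReal_mul (by positivity)]
          congr 1; ring
  -- K4
  have hK4 : ∫⁻ r in Ioi b, ENNReal.ofReal (r ^ 2) * ENNReal.ofReal (g r * |deriv g r|) = 0 := by
    rw [setLIntegral_congr_fun measurableSet_Ioi (g := fun _ => 0) fun r hr => ?_, lintegral_zero]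
    rw [hg, (dysonG_beyond hR hW hθ₁ hθ₂ (by linarith) (le_of_lt hr)).2]
    simp
  rw [hK4, add_zero]
  calc _ ≤ (ENNReal.ofReal ((R₁ + 1) ^ 3 / 2) +
        2⁻¹ * ∫⁻ r in Ioc 0 (R₁ + 1), ENNReal.ofReal (r ^ 2 * deriv g r ^ 2)) +
        (ENNReal.ofReal ((1 - c) * annulusCap R₁ b * b) + ENNReal.ofReal (b ^ 2 * C_B * θ₂)) :=
        add_le_add hK1 (add_le_add hK2 hK3)
    _ = _ := by ring

end ProfileBounds

/-! ### Assembly: the profile of Theorem 2.2 -/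

section Assembly

variable {v : ℝ → ℝ≥0∞}

/-- **Choice of the error budget.** The final energy bound
`(1 + 2ρ)² (a + ρ) b/(b - a - ρ) + 20 ρ R₁` tends to `ab/(b - a)` as `ρ → 0`. [folklore] -/
theorem exists_rho {a b R₁ ε₁ : ℝ} (ha : 0 < a) (hab : a < b) (hR : 0 < R₁) (hε : 0 < ε₁) :
    ∃ ρ : ℝ, 0 < ρ ∧ ρ ≤ 1 / 2 ∧ ρ ≤ a / 20 ∧ ρ * R₁ ≤ a / 80 ∧ a + ρ < b ∧
      (1 + 2 * ρ) ^ 2 * ((a + ρ) * b / (b - a - ρ)) + 20 * ρ * R₁ < a * b / (b - a) + ε₁ / 2 := by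
  set F : ℝ → ℝ := fun ρ => (1 + 2 * ρ) ^ 2 * ((a + ρ) * b / (b - a - ρ)) + 20 * ρ * R₁ with hF
  have hF0 : F 0 = a * b / (b - a) := by simp [hF]
  have hcont : ContinuousAt F 0 := by
    simp only [hF]
    refine ContinuousAt.add (ContinuousAt.mul (by fun_prop) (ContinuousAt.div (by fun_prop)
      (by fun_prop) (by simp; linarith))) (by fun_prop)
  obtain ⟨δ, hδ, hδF⟩ := Metric.continuousAt_iff.mp hcont (ε₁ / 2) (by positivity)
  set ρ : ℝ := min (δ / 2) (min (1 / 2) (min (a / 20) (min (a / (80 * R₁)) ((b - a) / 2)))) with hρ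
  have hρ0 : 0 < ρ := by
    simp only [hρ, lt_min_iff]; exact ⟨by linarith, by norm_num, by positivity, by positivity, by linarith⟩
  have h1 : ρ ≤ δ / 2 := min_le_left _ _
  have h2 : ρ ≤ 1 / 2 := (min_le_right _ _).trans (min_le_left _ _)
  have h3 : ρ ≤ a / 20 := (min_le_right _ _).trans ((min_le_right _ _).trans (min_le_left _ _))
  have h4 : ρ ≤ a / (80 * R₁) :=
    (min_le_right _ _).trans ((min_le_right _ _).trans ((min_le_right _ _).trans (min_le_left _ _)))
  have h5 : ρ ≤ (b - a) / 2 :=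
    (min_le_right _ _).trans ((min_le_right _ _).trans ((min_le_right _ _).trans (min_le_right _ _)))
  refine ⟨ρ, hρ0, h2, h3, ?_, by linarith, ?_⟩
  · rw [le_div_iff₀ (by positivity)] at h4; linarith
  · have := hδF (x := ρ) (by rw [dist_zero_right, Real.norm_eq_abs, abs_of_pos hρ0]; linarith)
    rw [hF0, Real.dist_eq, abs_lt] at this
    linarith [this.2]

/-- **A good ray.** If `a < A` there is a `C¹` function `h` on a ray with inner energy
`k₀ = ∫_{(0,R₁]} r²(h'² + ½vh²)` and junction value `c = h(R₁)` satisfying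
`k₀ + (1 - c)² R₁ < A` (ray of a near-minimiser + capacity of the annulus beyond `R₁`).
[cite: LSSY2005, App. C, Thm. C.1 (C.8)] -/
theorem exists_good_ray (hv : Measurable v) (ha : scatteringLength v ≠ ⊤) {A R₁ : ℝ}
    (hA : (scatteringLength v).toReal < A) (hR : 0 < R₁) :
    ∃ h : ℝ → ℝ, ContDiff ℝ 1 h ∧ ∃ k₀ : ℝ, 0 ≤ k₀ ∧
      (∫⁻ r in Ioc 0 R₁, rayDensity v h r) = ENNReal.ofReal k₀ ∧ k₀ + (1 - h R₁) ^ 2 * R₁ < A := by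
  have hA0 : 0 < A := lt_of_le_of_lt ENNReal.toReal_nonneg hA
  obtain ⟨φ, hφ, ⟨Rφ, hRφ⟩, ω, hω⟩ := exists_ray_lt hv ha hA
  set h := rayFun φ ω with hh_def
  have hh : ContDiff ℝ 1 h := contDiff_rayFun hφ.1 ω
  set R' : ℝ := max Rφ R₁ + 1 with hR'
  have hR₁R' : R₁ ≤ R' := by have := le_max_right Rφ R₁; linarith
  have h1 : h R' = 1 := by
    refine hRφ _ ?_
    rw [norm_smul, norm_eq_of_mem_sphere ω, mul_one, Real.norm_of_nonneg (by linarith)]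
    have := le_max_left Rφ R₁; linarith
  have heh : ∫⁻ r in Ioi 0, rayDensity v h r < ENNReal.ofReal A := hω
  have hsplit := lintegral_Ioi_eq_add hR.le (rayDensity v h)
  set k₀E := ∫⁻ r in Ioc 0 R₁, rayDensity v h r with hk₀E
  have hetop : (∫⁻ r in Ioi 0, rayDensity v h r) ≠ ⊤ := ne_top_of_lt heh
  have hk₀top : k₀E ≠ ⊤ := ne_top_of_le_ne_top hetop (hsplit ▸ le_self_add)
  refine ⟨h, hh, k₀E.toReal, ENNReal.toReal_nonneg, (ENNReal.ofReal_toReal hk₀top).symm, ?_⟩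
  have hcap : ENNReal.ofReal ((1 - h R₁) ^ 2 * R₁) ≤ ∫⁻ r in Ioi R₁, rayDensity v h r :=
    (ray_capacity hh hR hR₁R' h1).trans ((lintegral_mono fun r => ofReal_sq_deriv_le_rayDensity v h r).trans
      (lintegral_mono_set Ioc_subset_Ioi_self))
  have hsum : ENNReal.ofReal (k₀E.toReal + (1 - h R₁) ^ 2 * R₁) < ENNReal.ofReal A := by
    rw [ENNReal.ofReal_add ENNReal.toReal_nonneg (by positivity), ENNReal.ofReal_toReal hk₀top]
    refine lt_of_le_of_lt ?_ heh
    rw [hsplit]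
    exact add_le_add le_rfl hcap
  exact (ENNReal.ofReal_lt_ofReal_iff hA0).mp hsum

/-- **The inner function**: cut the ray off at the origin at cost `≤ ρ/2`. [folklore] -/
theorem exists_inner (hv : Measurable v) {h : ℝ → ℝ} (hh : ContDiff ℝ 1 h) {R₁ : ℝ} (hR1 : 1 ≤ R₁)
    {k₀ : ℝ} (hk₀0 : 0 ≤ k₀) (hk₀ : (∫⁻ r in Ioc 0 R₁, rayDensity v h r) = ENNReal.ofReal k₀) {ρ : ℝ}
    (hρ : 0 < ρ) :
    ∃ h₁ : ℝ → ℝ, ContDiff ℝ 1 h₁ ∧ (∃ δ₀ : ℝ, 0 < δ₀ ∧ δ₀ ≤ 1 / 2 ∧ ∀ r, r ≤ δ₀ → h₁ r = 0) ∧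
      h₁ R₁ = h R₁ ∧
      ∃ k : ℝ, 0 ≤ k ∧ k ≤ k₀ + ρ / 2 ∧ (∫⁻ r in Ioc 0 R₁, rayDensity v h₁ r) = ENNReal.ofReal k := by
  obtain ⟨C₀, hC₀0, hC₀⟩ := exists_originCut_bound hh
  set δ₀ : ℝ := min (1 / 2) (ρ / (2 * (C₀ + 1))) with hδ₀
  have hδ₀0 : 0 < δ₀ := lt_min (by norm_num) (by positivity)
  have hδ₀1 : δ₀ ≤ 1 / 2 := min_le_left _ _
  have hCδ : C₀ * δ₀ ≤ ρ / 2 := by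
    calc C₀ * δ₀ ≤ C₀ * (ρ / (2 * (C₀ + 1))) := mul_le_mul_of_nonneg_left (min_le_right _ _) hC₀0
      _ = ρ / 2 * (C₀ / (C₀ + 1)) := by field_simp
      _ ≤ ρ / 2 * 1 := mul_le_mul_of_nonneg_left ((div_le_one (by positivity)).mpr (by linarith)) (by positivity)
      _ = ρ / 2 := mul_one _
  set h₁ := originCut δ₀ h with hh₁_def
  have hh₁ : ContDiff ℝ 1 h₁ := originCut_contDiff hh δ₀
  have hbound := lintegral_rayDensity_originCut_le (R₁ := R₁) hv hh hδ₀0 (hC₀ δ₀ hδ₀0 hδ₀1)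
  rw [hk₀] at hbound
  set kE := ∫⁻ r in Ioc 0 R₁, rayDensity v h₁ r with hkE
  have hkE' : kE ≤ ENNReal.ofReal (k₀ + ρ / 2) := by
    refine hbound.trans ?_
    rw [← ENNReal.ofReal_add hk₀0 (by positivity)]
    exact ENNReal.ofReal_le_ofReal (by linarith)
  have hktop : kE ≠ ⊤ := ne_top_of_le_ne_top ENNReal.ofReal_ne_top hkE'
  refine ⟨h₁, hh₁, ⟨δ₀, hδ₀0, hδ₀1, fun r hr => originCut_of_le hδ₀0 hr⟩,
    originCut_of_ge hδ₀0 (by linarith), kE.toReal, ENNReal.toReal_nonneg,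
    ENNReal.toReal_le_of_le_ofReal (by positivity) hkE', (ENNReal.ofReal_toReal hktop).symm⟩

/-- `(1 - c'')² ≤ (1 - c')² + 4τ` for `c', c'' ∈ [0, 1]` with `|c'' - c'| ≤ 2τ`. [folklore] -/
theorem one_sub_sq_le {c' c'' τ : ℝ} (h0 : 0 ≤ c') (h1 : c' ≤ 1) (h0' : 0 ≤ c'') (h1' : c'' ≤ 1)
    (h : |c'' - c'| ≤ 2 * τ) : (1 - c'') ^ 2 ≤ (1 - c') ^ 2 + 4 * τ := by
  have h2 : (1 - c'') ^ 2 - (1 - c') ^ 2 = (c' - c'') * (2 - c' - c'') := by ring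
  have h3 : (c' - c'') * (2 - c' - c'') ≤ |c'' - c'| * 2 := by
    calc (c' - c'') * (2 - c' - c'') ≤ |c' - c''| * (2 - c' - c'') :=
          mul_le_mul_of_nonneg_right (le_abs_self _) (by linarith)
      _ ≤ |c' - c''| * 2 := mul_le_mul_of_nonneg_left (by linarith) (abs_nonneg _)
      _ = |c'' - c'| * 2 := by rw [abs_sub_comm]
  nlinarith

/-- Four `ofReal` terms, the second halved. [folklore] -/
theorem ofReal_four_terms {p q r s : ℝ} (hp : 0 ≤ p) (hq : 0 ≤ q) (hr : 0 ≤ r) (hs : 0 ≤ s) :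
    ENNReal.ofReal p + 2⁻¹ * ENNReal.ofReal q + ENNReal.ofReal r + ENNReal.ofReal s =
      ENNReal.ofReal (p + q / 2 + r + s) := by
  have h2 : (2⁻¹ : ℝ≥0∞) * ENNReal.ofReal q = ENNReal.ofReal (q / 2) := by
    rw [← ENNReal.ofReal_ofNat 2, ← ENNReal.ofReal_inv_of_pos two_pos, ← ENNReal.ofReal_mul (by norm_num)]
    congr 1; ring
  rw [h2, ← ENNReal.ofReal_add hp (by positivity), ← ENNReal.ofReal_add (by positivity) hr,
    ← ENNReal.ofReal_add (by positivity) hs]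

/-- The energy budget (pure real arithmetic). [folklore] -/
theorem energy_budget {a b ρ R₁ κ lam k c' c'' L₁ L₂ ε₁ : ℝ} (hρ : 0 < ρ) (hκ0 : 0 < κ)
    (hκ2 : κ ≤ 2 * R₁)
    (hH : lam ^ 2 * k + (1 - c') ^ 2 * κ ≤ (a + ρ) * b / (b - a - ρ))
    (hsq : (1 - c'') ^ 2 ≤ (1 - c') ^ 2 + 4 * ρ) (hL₁ : L₁ ≤ ε₁ / 4) (hL₂ : L₂ ≤ ε₁ / 4)
    (hF : (1 + 2 * ρ) ^ 2 * ((a + ρ) * b / (b - a - ρ)) + 20 * ρ * R₁ < a * b / (b - a) + ε₁ / 2) :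
    (1 + 2 * ρ) ^ 2 * lam ^ 2 * k + L₁ + (1 - c'') ^ 2 * κ + L₂ ≤ a * b / (b - a) + ε₁ := by
  have h1 : (1 - c'') ^ 2 * κ ≤ (1 - c') ^ 2 * κ + 4 * ρ * κ := by
    have := mul_le_mul_of_nonneg_right hsq hκ0.le; linarith
  have h2 : 4 * ρ * κ ≤ 8 * ρ * R₁ := by nlinarith
  have h3 : (1 - c') ^ 2 * κ ≤ (1 + 2 * ρ) ^ 2 * ((1 - c') ^ 2 * κ) := by
    have h12 : 1 ≤ (1 + 2 * ρ) ^ 2 := by nlinarith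
    have h0 : 0 ≤ (1 - c') ^ 2 * κ := by positivity
    nlinarith
  have h4 : (1 + 2 * ρ) ^ 2 * (lam ^ 2 * k + (1 - c') ^ 2 * κ) ≤
      (1 + 2 * ρ) ^ 2 * ((a + ρ) * b / (b - a - ρ)) := mul_le_mul_of_nonneg_left hH (by positivity)
  have h5 : 0 ≤ ρ * R₁ := by nlinarith
  nlinarith

/-- `ab/(b - a) ≤ 11a/10` for `b ≥ 20a`. [folklore] -/
theorem ab_div_le {a b : ℝ} (ha : 0 < a) (hb : 20 * a ≤ b) : a * b / (b - a) ≤ 11 * a / 10 := by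
  rw [div_le_div_iff₀ (by linarith) (by norm_num)]; nlinarith

/-- The size of the tail coefficient `(1 - c'')κ ≤ 6a/5`. [folklore] -/
theorem tail_coeff_le {a b ρ R₁ κ c' c'' : ℝ} (ha : 0 < a) (hb : 20 * a ≤ b) (hρ0 : 0 < ρ)
    (hρa : ρ ≤ a / 20) (hρR : ρ * R₁ ≤ a / 80) (hκ0 : 0 < κ) (hκ2 : κ ≤ 2 * R₁)
    (hH2 : (1 - c') * κ ≤ (a + ρ) * b / (b - a - ρ)) (hcc : c' - c'' ≤ 2 * ρ) :
    (1 - c'') * κ ≤ 6 * a / 5 := by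
  have h1 : (a + ρ) * b / (b - a - ρ) ≤ 23 * a / 20 := by
    rw [div_le_div_iff₀ (by linarith) (by norm_num)]
    nlinarith [mul_le_mul_of_nonneg_right hρa (by linarith : (0 : ℝ) ≤ b)]
  have h2 : (1 - c'') * κ ≤ (1 - c') * κ + 2 * ρ * κ := by nlinarith
  have h3 : 2 * ρ * κ ≤ a / 20 := by nlinarith
  linarith

/-- The volume-defect budget. [folklore] -/
theorem defect_budget {a b R₁ t : ℝ} (ha : 0 < a) (hcube : (R₁ + 1) ^ 3 ≤ 3 * a * b ^ 2)
    (ht : t ≤ 6 * a / 5) :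
    4 * Real.pi * ((R₁ + 1) ^ 3 + t * b ^ 2 / 2) ≤ 16 * Real.pi * a * b ^ 2 := by
  have hπ := Real.pi_pos
  have h1 : t * b ^ 2 ≤ 6 * a / 5 * b ^ 2 := mul_le_mul_of_nonneg_right ht (sq_nonneg _)
  nlinarith [mul_pos hπ ha, mul_nonneg hπ.le (sq_nonneg b), mul_nonneg (mul_nonneg hπ.le ha.le) (sq_nonneg b)]

/-- The budget for `K`. [folklore] -/
theorem K_budget {a b R₁ s t u : ℝ} (ha : 0 < a) (hb1 : 1 ≤ b) (hcube : (R₁ + 1) ^ 3 ≤ 3 * a * b)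
    (hs0 : 0 ≤ s) (hs : s ≤ 6 * a / 5) (ht : t ≤ 6 * a / 5) (hu : u ≤ a * b / 10) :
    4 * Real.pi * ((R₁ + 1) ^ 3 / 2 + s / 2 + t * b + u) ≤ 16 * Real.pi * a * b := by
  have hπ := Real.pi_pos
  have h1 : t * b ≤ 6 * a / 5 * b := mul_le_mul_of_nonneg_right ht (by linarith)
  have h2 : s ≤ 6 * a / 5 * b := hs.trans (by nlinarith)
  have h3 : (R₁ + 1) ^ 3 / 2 + s / 2 + t * b + u ≤ 4 * a * b := by nlinarith
  nlinarith [mul_le_mul_of_nonneg_left h3 (by positivity : (0 : ℝ) ≤ 4 * Real.pi)]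

/-- Choice of the width of the outer gluing layer. [folklore] -/
theorem exists_theta₂ {ε₁ a b C : ℝ} (hε : 0 < ε₁) (ha : 0 < a) (hb : 0 < b) (hC : 0 ≤ C) :
    ∃ θ : ℝ, 0 < θ ∧ θ ≤ 1 ∧ (b - θ + 1) ^ 2 * C ^ 2 * θ ≤ ε₁ / 4 ∧ b ^ 2 * C * θ ≤ a * b / 10 := by
  set θ : ℝ := min 1 (min (ε₁ / (4 * ((b + 1) ^ 2 * C ^ 2 + 1))) (a / (10 * (b * C + 1)))) with hθ
  have h0 : 0 < θ := lt_min one_pos (lt_min (by positivity) (by positivity))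
  have h1' : θ ≤ 1 := min_le_left _ _
  refine ⟨θ, h0, h1', ?_, ?_⟩
  · have h1 : θ ≤ ε₁ / (4 * ((b + 1) ^ 2 * C ^ 2 + 1)) := (min_le_right _ _).trans (min_le_left _ _)
    have h2 : (b - θ + 1) ^ 2 ≤ (b + 1) ^ 2 := pow_le_pow_left₀ (by linarith) (by linarith) 2
    calc (b - θ + 1) ^ 2 * C ^ 2 * θ ≤ (b + 1) ^ 2 * C ^ 2 * θ := by gcongr
      _ ≤ ((b + 1) ^ 2 * C ^ 2 + 1) * (ε₁ / (4 * ((b + 1) ^ 2 * C ^ 2 + 1))) :=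
          mul_le_mul (by linarith) h1 h0.le (by positivity)
      _ = ε₁ / 4 := by field_simp
  · have h1 : θ ≤ a / (10 * (b * C + 1)) := (min_le_right _ _).trans (min_le_right _ _)
    calc b ^ 2 * C * θ ≤ b ^ 2 * C * (a / (10 * (b * C + 1))) :=
          mul_le_mul_of_nonneg_left h1 (by positivity)
      _ = a * b / 10 * (b * C / (b * C + 1)) := by field_simp
      _ ≤ a * b / 10 * 1 :=
          mul_le_mul_of_nonneg_left ((div_le_one (by positivity)).mpr (by linarith)) (by positivity)
      _ = a * b / 10 := mul_one _

/-- Choice of the width of the inner gluing layer. [folklore] -/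
theorem exists_theta₁ {ε₁ R C : ℝ} (hε : 0 < ε₁) :
    ∃ θ : ℝ, 0 < θ ∧ θ ≤ 1 ∧ (R + 1) ^ 2 * C ^ 2 * θ ≤ ε₁ / 4 := by
  refine ⟨min 1 (ε₁ / (4 * ((R + 1) ^ 2 * C ^ 2 + 1))), lt_min one_pos (by positivity),
    min_le_left _ _, ?_⟩
  have h1 := min_le_right 1 (ε₁ / (4 * ((R + 1) ^ 2 * C ^ 2 + 1)))
  have h0 : 0 < min 1 (ε₁ / (4 * ((R + 1) ^ 2 * C ^ 2 + 1))) := lt_min one_pos (by positivity)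
  calc (R + 1) ^ 2 * C ^ 2 * min 1 (ε₁ / (4 * ((R + 1) ^ 2 * C ^ 2 + 1)))
      ≤ ((R + 1) ^ 2 * C ^ 2 + 1) * (ε₁ / (4 * ((R + 1) ^ 2 * C ^ 2 + 1))) :=
        mul_le_mul (by linarith) h1 h0.le (by positivity)
    _ = ε₁ / 4 := by field_simp

/-- `8πa/(1 - a/b) = 8π · ab/(b - a)`. [folklore] -/
theorem eight_pi_mul_div {a b : ℝ} (hb : 0 < b) (hab : a < b) :
    8 * Real.pi * a / (1 - a / b) = 8 * Real.pi * (a * b / (b - a)) := by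
  have hba : b - a ≠ 0 := (sub_pos.mpr hab).ne'
  have hb0 : b ≠ 0 := hb.ne'
  field_simp

/-- **LSSY 2005, App. C Thm. C.1 (C.8) as a trial profile, proved** (step 1 of Thm. 2.2): for
`0 < a < ∞` and `b ≥ b₀(v)` there are pair profiles with cut-off `b`,
`E₁ ≤ 8πa/(1 - a/b) + ε`, `I ≤ 16πab²`, `K ≤ 16πab`. The profile is radial, `g(|x|)` with `g` the
glued function `dysonG`: inner part a clamped and scaled ray of a near-minimiser of the
scattering functional cut off at the origin, then the harmonic tail `1 - a'(1/r - 1/b)`, then `1`.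
[cite: LSSY2005, App. C, Thm. C.1 (C.4)–(C.8); Thm. 2.2, proof, (2.17)–(2.18), (2.27)–(2.32)] -/
theorem LSSY2005_dysonProfile_holds : LSSY2005_dysonProfile := by
  intro v R₀ hv hvR haT ha0
  -- the data
  set a := (scatteringLength v).toReal with ha_def
  have ha : 0 < a := ENNReal.toReal_pos ha0.ne' haT
  set R₁ : ℝ := max R₀ 0 + 1 with hR₁
  have hR₁1 : 1 ≤ R₁ := by have := le_max_right R₀ 0; linarith
  have hR₁0 : 0 < R₁ := by linarith
  have hvR₁ : ∀ r, R₁ ≤ r → v r = 0 := fun r hr => hvR r (by have := le_max_left R₀ 0; linarith)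
  set b₀ : ℝ := 20 * a + 4 * R₁ + 4 + (R₁ + 1) ^ 3 / (3 * a) with hb₀
  have hcube : 0 ≤ (R₁ + 1) ^ 3 / (3 * a) := by positivity
  refine ⟨b₀, by linarith, fun b ε hb hε => ?_⟩
  dsimp only
  -- consequences of `b ≥ b₀`
  have hb20 : 20 * a ≤ b := by linarith
  have hbR : 4 * R₁ + 4 ≤ b := by linarith
  have hb1 : 1 ≤ b := by linarith
  have hb0 : 0 < b := by linarith
  have hab : a < b := by linarith
  have hR₁b : R₁ < b := by linarith
  have hb2 : R₁ + 2 ≤ b := by linarith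
  have hcube1 : (R₁ + 1) ^ 3 ≤ 3 * a * b := by
    have h1 : (R₁ + 1) ^ 3 / (3 * a) ≤ b := by linarith
    rw [div_le_iff₀ (by positivity)] at h1; linarith
  have hcube2 : (R₁ + 1) ^ 3 ≤ 3 * a * b ^ 2 :=
    hcube1.trans (by nlinarith [mul_nonneg ha.le (mul_nonneg hb0.le (by linarith : (0 : ℝ) ≤ b - 1))])
  -- error budget
  set ε₁ : ℝ := min (ε / (8 * Real.pi)) (a / 10) with hε₁
  have hε₁0 : 0 < ε₁ := lt_min (by positivity) (by positivity)
  have hε₁ε : 8 * Real.pi * ε₁ ≤ ε := by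
    have := min_le_left (ε / (8 * Real.pi)) (a / 10)
    rw [← hε₁, le_div_iff₀ (by positivity)] at this; linarith
  have hε₁a : ε₁ ≤ a / 10 := min_le_right _ _
  obtain ⟨ρ, hρ0, hρ12, hρa, hρR, haρb, hF⟩ := exists_rho (ε₁ := ε₁) ha hab hR₁0 hε₁0
  -- Step 1: a good ray and the inner function
  obtain ⟨h, hh, k₀, hk₀0, hk₀E, hray⟩ := exists_good_ray (R₁ := R₁) hv haT
    (show (scatteringLength v).toReal < a + ρ / 2 by rw [← ha_def]; linarith) hR₁0
  obtain ⟨h₁, hh₁, ⟨δ₀, hδ₀, hδ₀1, hh₁0⟩, hh₁R, k, hk0, hkk₀, hkE⟩ :=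
    exists_inner hv hh hR₁1 hk₀0 hk₀E hρ0
  have heρ : k + (1 - h R₁) ^ 2 * R₁ ≤ a + ρ := by linarith
  have heb : k + (1 - h R₁) ^ 2 * R₁ < b := by linarith
  -- Step 2: the optimal scale and the clamped inner part
  have hκ0 : 0 < annulusCap R₁ b := annulusCap_pos hR₁0 hR₁b
  have hκ2 : annulusCap R₁ b ≤ 2 * R₁ := annulusCap_le hR₁0 (by linarith)
  obtain ⟨lam, hlam⟩ : ∃ lam : ℝ, lam = h R₁ * annulusCap R₁ b / (k + h R₁ ^ 2 * annulusCap R₁ b) :=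
    ⟨_, rfl⟩
  obtain ⟨hH1, hH2, hc'0, hc'1⟩ := harmonic_comparison (c := h R₁) hk0 hR₁0 hR₁b le_rfl heb
  rw [← hlam] at hH1 hH2 hc'0 hc'1
  have hmono : (k + (1 - h R₁) ^ 2 * R₁) * b / (b - (k + (1 - h R₁) ^ 2 * R₁)) ≤
      (a + ρ) * b / (b - a - ρ) := by
    have := mul_div_sub_mono heρ haρb; rwa [show b - (a + ρ) = b - a - ρ by ring] at this
  obtain ⟨W, hW_def⟩ : ∃ W : ℝ → ℝ, W = fun r => clamp ρ (lam * h₁ r) := ⟨_, rfl⟩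
  have hW : ContDiff ℝ 1 W := hW_def ▸ (clamp_contDiff ρ).comp (contDiff_const.mul hh₁)
  have hW01 : ∀ r, 0 ≤ W r ∧ W r ≤ 1 := fun r => by
    rw [hW_def]; exact ⟨clamp_nonneg hρ0 _, clamp_le_one hρ0 _⟩
  have hW0 : ∀ r, r ≤ δ₀ → W r = 0 := fun r hr => by
    rw [hW_def]; simp only [hh₁0 r hr, mul_zero]; exact clamp_of_nonpos hρ0 le_rfl
  have hWR₁ : W R₁ = clamp ρ (lam * h R₁) := by rw [hW_def]; dsimp only; rw [hh₁R]
  have hc''0 : 0 ≤ W R₁ := (hW01 R₁).1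
  have hc''1 : W R₁ ≤ 1 := (hW01 R₁).2
  have hcc : |W R₁ - lam * h R₁| ≤ 2 * ρ := by
    rw [hWR₁]; exact abs_clamp_sub_le hρ0 hρ12 ⟨hc'0, hc'1⟩
  have hWE : ∫⁻ r in Ioc 0 R₁, rayDensity v W r ≤ ENNReal.ofReal ((1 + 2 * ρ) ^ 2 * lam ^ 2 * k) := by
    rw [hW_def]
    refine (lintegral_rayDensity_clamp_le hh₁ hρ0 lam (Ioc 0 R₁)).trans ?_
    rw [hkE, ← ENNReal.ofReal_mul (by positivity)]
  -- Step 3: the outer part and the two gluing widths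
  obtain ⟨C_B, hCB0, hCB⟩ := exists_deriv_glue_bound (tailFun_contDiff hR₁0 b (W R₁))
    (contDiff_const (c := (1 : ℝ))) (b - 1) b
  obtain ⟨θ₂, hθ₂0, hθ₂1, hθ₂E, hθ₂K⟩ := exists_theta₂ (C := C_B) hε₁0 ha hb0 hCB0
  have hCB' : ∀ r ∈ Icc (b - θ₂) (b - θ₂ + θ₂), |deriv (outerG R₁ b θ₂ (W R₁)) r| ≤ C_B :=
    hCB (b - θ₂) θ₂ hθ₂0 hθ₂1 (by linarith) (by linarith)
      (Or.inr (by rw [sub_add_cancel]; exact tailFun_b hR₁0 hR₁b))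
  obtain ⟨C_A, hCA0, hCA⟩ := exists_deriv_glue_bound hW (outerG_contDiff hR₁0 b θ₂ (W R₁)) R₁ (R₁ + 1)
  obtain ⟨θ₁, hθ₁0, hθ₁1, hθ₁E⟩ := exists_theta₁ (R := R₁) (C := C_A) hε₁0
  have hWR : W R₁ = outerG R₁ b θ₂ (W R₁) R₁ := by
    rw [outerG_of_le hθ₂0 (by linarith), tailFun_R₁ hR₁0 hR₁b]
  have hCA' : ∀ r ∈ Icc R₁ (R₁ + θ₁), |deriv (dysonG R₁ b θ₁ θ₂ (W R₁) W) r| ≤ C_A :=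
    hCA R₁ θ₁ hθ₁0 hθ₁1 le_rfl (by linarith) (Or.inl hWR)
  obtain ⟨g, hg_def⟩ : ∃ g : ℝ → ℝ, g = dysonG R₁ b θ₁ θ₂ (W R₁) W := ⟨_, rfl⟩
  have hgd : ContDiff ℝ 1 g := hg_def ▸ dysonG_contDiff hR₁0 hW b θ₁ θ₂ (W R₁)
  have hCB'' : ∀ r ∈ Icc (b - θ₂) (b - θ₂ + θ₂), |deriv (dysonG R₁ b θ₁ θ₂ (W R₁) W) r| ≤ C_B := by
    intro r hr
    rw [deriv_dysonG_of_ge hR₁0 hW hθ₁0 (by linarith [hr.1])]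
    exact hCB' r hr
  have hg01 : ∀ r, 0 ≤ g r ∧ g r ≤ 1 := fun r =>
    hg_def ▸ dysonG_mem hR₁0 hR₁b hθ₁0 hθ₂0 hc''0 hc''1 hW01 r
  -- Step 4: the integrals of `g`
  have hE := dysonG_energy_le (v := v) hvR₁ hR₁0 hW hθ₁0 hθ₁1 hθ₂0 hθ₂1 hb2 hCA' hCB''
  have hD := dysonG_defect_le hR₁0 hW hθ₁0 hθ₁1 hθ₂0 hb2 hc''0 hc''1 hW01
  have hK := dysonG_K_le hR₁0 hW hθ₁0 hθ₁1 hθ₂0 hθ₂1 hb2 hc''0 hc''1 hW01 hCB''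
  rw [← hg_def] at hE hD hK
  have hsq := one_sub_sq_le hc'0 hc'1 hc''0 hc''1 hcc
  have hbudget := energy_budget (L₁ := (R₁ + 1) ^ 2 * C_A ^ 2 * θ₁)
    (L₂ := (b - θ₂ + 1) ^ 2 * C_B ^ 2 * θ₂) hρ0 hκ0 hκ2 (hH1.trans hmono) hsq hθ₁E hθ₂E hF
  have htail : (1 - W R₁) * annulusCap R₁ b ≤ 6 * a / 5 :=
    tail_coeff_le (c'' := W R₁) ha hb20 hρ0 hρa hρR hκ0 hκ2 (hH2.trans hmono)
      (by linarith [(abs_le.mp hcc).1])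
  set X : ℝ := (1 + 2 * ρ) ^ 2 * lam ^ 2 * k + (R₁ + 1) ^ 2 * C_A ^ 2 * θ₁ +
    (1 - W R₁) ^ 2 * annulusCap R₁ b + (b - θ₂ + 1) ^ 2 * C_B ^ 2 * θ₂ with hX
  have hX0 : 0 ≤ X := by positivity
  have hEX : ∫⁻ r in Ioi 0, rayDensity v g r ≤ ENNReal.ofReal X := by
    refine hE.trans ?_
    rw [hX, ENNReal.ofReal_add (by positivity) (by positivity),
      ENNReal.ofReal_add (by positivity) (by positivity), ENNReal.ofReal_add (by positivity) (by positivity)]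
    exact add_le_add (add_le_add (add_le_add hWE le_rfl) le_rfl) le_rfl
  have hX65 : X ≤ 6 * a / 5 := by
    have := ab_div_le ha hb20; linarith
  -- Step 5: the profile on `ℝ³`
  refine ⟨radialFun g, ?_, ?_, ?_, ?_⟩
  · -- admissibility
    refine ⟨radialFun_contDiff hgd hδ₀ fun r hr => ?_, fun x => (hg01 _).1, fun x => (hg01 _).2,
      radialFun_neg, fun x hx => ?_⟩
    · rw [hg_def, dysonG_of_le hθ₁0 (by linarith), dysonG_of_le hθ₁0 hR₁0.le, hW0 r hr, hW0 0 hδ₀.le]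
    · rw [hg_def]; exact (dysonG_beyond hR₁0 hW hθ₁0 hθ₂0 (by linarith) hx).1
  · -- the energy
    calc profileEnergy v (radialFun g)
        = 2 * (ENNReal.ofReal (4 * Real.pi) * ∫⁻ r in Ioi 0, rayDensity v g r) :=
          profileEnergy_radialFun hgd hv
      _ ≤ 2 * (ENNReal.ofReal (4 * Real.pi) * ENNReal.ofReal X) :=
          mul_le_mul' le_rfl (mul_le_mul' le_rfl hEX)
      _ = ENNReal.ofReal (8 * Real.pi * X) := by
          rw [← ENNReal.ofReal_ofNat 2, ← ENNReal.ofReal_mul (by positivity),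
            ← ENNReal.ofReal_mul (by norm_num)]
          congr 1; ring
      _ ≤ _ := by
          refine ENNReal.ofReal_le_ofReal ?_
          rw [eight_pi_mul_div hb0 hab]
          have := mul_le_mul_of_nonneg_left hbudget (by positivity : (0 : ℝ) ≤ 8 * Real.pi)
          linarith
  · -- the volume defect
    calc profileDefect (radialFun g) = ENNReal.ofReal (4 * Real.pi) * _ :=
          profileDefect_radialFun hgd.continuous
      _ ≤ ENNReal.ofReal (4 * Real.pi) * (ENNReal.ofReal ((R₁ + 1) ^ 3) +
            ENNReal.ofReal ((1 - W R₁) * annulusCap R₁ b * b ^ 2 / 2)) := mul_le_mul' le_rfl hD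
      _ = ENNReal.ofReal (4 * Real.pi * ((R₁ + 1) ^ 3 + (1 - W R₁) * annulusCap R₁ b * b ^ 2 / 2)) := by
          rw [← ENNReal.ofReal_add (by positivity) (by
            have : 0 ≤ (1 - W R₁) * annulusCap R₁ b := mul_nonneg (by linarith) hκ0.le
            positivity), ← ENNReal.ofReal_mul (by positivity)]
      _ ≤ _ := ENNReal.ofReal_le_ofReal (defect_budget ha hcube2 htail)
  · -- the integral `K`
    have hkin : ∫⁻ r in Ioc 0 (R₁ + 1), ENNReal.ofReal (r ^ 2 * deriv g r ^ 2) ≤ ENNReal.ofReal X :=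
      ((lintegral_mono fun r => ofReal_sq_deriv_le_rayDensity v g r).trans
        (lintegral_mono_set Ioc_subset_Ioi_self)).trans hEX
    have hκc : 0 ≤ (1 - W R₁) * annulusCap R₁ b := mul_nonneg (by linarith) hκ0.le
    have hK2 : (∫⁻ r in Ioi 0, ENNReal.ofReal (r ^ 2) * ENNReal.ofReal (g r * |deriv g r|)) ≤
        ENNReal.ofReal ((R₁ + 1) ^ 3 / 2 + X / 2 + (1 - W R₁) * annulusCap R₁ b * b +
          b ^ 2 * C_B * θ₂) := by
      refine hK.trans (le_of_le_of_eq ?_ (ofReal_four_terms (by positivity) hX0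
        (mul_nonneg hκc hb0.le) (by positivity)))
      exact add_le_add (add_le_add (add_le_add le_rfl (mul_le_mul' le_rfl hkin)) le_rfl) le_rfl
    calc profileK (radialFun g) = ENNReal.ofReal (4 * Real.pi) * _ := profileK_radialFun hgd
      _ ≤ ENNReal.ofReal (4 * Real.pi) * ENNReal.ofReal ((R₁ + 1) ^ 3 / 2 + X / 2 +
          (1 - W R₁) * annulusCap R₁ b * b + b ^ 2 * C_B * θ₂) := mul_le_mul' le_rfl hK2
      _ = ENNReal.ofReal (4 * Real.pi * ((R₁ + 1) ^ 3 / 2 + X / 2 + (1 - W R₁) * annulusCap R₁ b * b +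
            b ^ 2 * C_B * θ₂)) := (ENNReal.ofReal_mul (by positivity)).symm
      _ ≤ _ := ENNReal.ofReal_le_ofReal (K_budget ha hb1 hcube1 hX0 hX65 htail hθ₂K)

end Assembly

end Literature.MathematicalPhysics.QuantumManyBody.BoseGas

end
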